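import HarnessLib
import Summits.HodgeConjecture.HodgeConjecture.Cruxes.H413.Lines.K2_E3_EllipticInputs   -- tier 0: the seven stubs + `ellipticInputs_of_line` (this module's compositions conclude its stubs BY NAME)
import Literature.NumberTheory.Automorphic.LocalIrrepAdmissible                              -- ★ named fact `UnitaryGroup.LocalIrrepAdmissible` (socket U12-g, ED. 2)
import Summits.HodgeConjecture.HodgeConjecture.Theorems.K2E3CharLocConstOnRegularSetOfLocal   -- ★ p855030 (K2E3-p09): row 9 ⟸ (13a) + (9L)  [ED. 2 re-tie]
import Summits.HodgeConjecture.HodgeConjecture.Theorems.K2E3CharLocIntOfLocal                 -- ★ p855065 (K2E3-p13): row 13 ⟸ (13a)         [ED. 2 re-tie]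
import Summits.HodgeConjecture.HodgeConjecture.Theorems.K2E3CharLocBddOfLocal                 -- ★ p855025 (K2E3-p14): row 14 PAID BY NAME       [ED. 2 re-tie]
import Summits.HodgeConjecture.HodgeConjecture.Theorems.K2E3NormalizedCharBddNearSemisimpleDescent -- ★ p855084 (K2E3-p12): row 12 ⟸ (12-S) + (12-D) [ED. 3 re-tie, R14 REL]
import Summits.HodgeConjecture.HodgeConjecture.Theorems.K2E3OrbitClosureContainsSemisimple    -- ★ p855250 (K2E3-p10): U12-b row 10 PAID BY NAME (all N, every finite v) — tied outright below (ED. 4)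
import Summits.HodgeConjecture.HodgeConjecture.Theorems.K2E3CayleySliceConjugatesNhds         -- ★ p855654 (K2E3-p12): U12-d₂ PAID BY NAME (★ p855570 non-split ∨ ★ p855631 split)  [ED. 5]
import Summits.HodgeConjecture.HodgeConjecture.Theorems.K2E3CharLocConstNearRegular                -- ★ p856174 (K2E3-p09 g2) ED. 6: U12-h (9L) `sig_K2E3CharLocConstNearRegular` PAID BY NAME   [ED. 6]
import Summits.HodgeConjecture.HodgeConjecture.Theorems.K2E3CharLocIntNearSemisimpleSupercuspidalOfTruncated   -- ★ p856184 (K2E3-p20 g3) ED. 6: (11-SC) composition consumed by the hosted (SC-an) tie §SC   [ED. 6]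
import Summits.HodgeConjecture.HodgeConjecture.Theorems.K2E3NormalizedCharBddOnCayleySliceOfLieCoreFixed   -- ★ (K2E3-p12 g3) ED. 7: U12-d₁ ⟸ U12-g + five Lie-core sockets §L (over ★ p856314 + ★ p856471; 0 def, no Lines cycle)   [ED. 7]
import Summits.HodgeConjecture.HodgeConjecture.Theorems.K2E3GL2NilpotentFourierRegularOfStructure   -- ★ p856788 (K2E3-p12 g3) ED. 8: (L-B_GL) :§L at N = 2 ⟸ (LBGL-2a) + (LBGL-2b); re-exports ★ p856457 `gl1_nilpotentFourierRegular` (N = 1)   [ED. 8]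
import Summits.HodgeConjecture.HodgeConjecture.Theorems.K2E3LocalIrrepAdmissibleQuasiSplit       -- ★ p856775 (K2E3-p09 g3) ED. 8: U12-g (13a) at every ODD N `localIrrepAdmissible_odd` hypothesis-free   [ED. 8]
import Summits.HodgeConjecture.HodgeConjecture.Theorems.K2E3LocalIrrepAdmissibleAnyKernel          -- ★ p857017 (K2E3-p10 g4) ED. 9: (13a-even) leaf PAID BY NAME `localIrrepAdmissible_even` ⇒ U12-g ★ on the line   [ED. 9]
import Summits.HodgeConjecture.HodgeConjecture.Theorems.K2E3CharLocIntIrreduciblePrincipalSeries        -- ★ p856831 (K2E3-p11 g3) ED. 10: row 11 (3b) irreducible principal series `charLocIntNearSemisimple_mk_cmPrincipalSeries`   [ED. 10]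
import Summits.HodgeConjecture.HodgeConjecture.Theorems.K2E3CharLocIntSteinbergClasses                   -- ★ p856946 (K2E3-p11 g3) ED. 10: row 11 (3c)+(3a case 1) `charLocIntNearSemisimple_of_isConstituentOf_cmPrincipalSeries_st`   [ED. 10]
import Summits.HodgeConjecture.HodgeConjecture.Theorems.K2E3CharLocIntNearModelTransport                 -- ★ (K2E3-p11) ED. 10: `charLocIntNear_of_map` (transport along `≃ₜ*`)   [ED. 10]
import Summits.HodgeConjecture.HodgeConjecture.Theorems.F0P3bNonsplitIdentification                      -- ★ ED. 10: `exists_formCongr_eq_smul_qsForm` (`U(H)(L⁺_v) ≃ U(Φ₃)(L⁺_v)`, N = 3, v non-split)   [ED. 10]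
import Summits.HodgeConjecture.HodgeConjecture.Theorems.K2E3LocalIrrepCuspidalOrPrincipalThree            -- ★ p857077 (K2E3-p11 g3) ED. 10: (11-3ns-cls) `sig_K2E3IrrClassCuspidalOrPrincipalThree` PAID BY NAME   [ED. 10]
import Summits.HodgeConjecture.HodgeConjecture.Theorems.K2E3GL2RegularNilpotentFourier                     -- ★ p857214 (K2E5-p10 g4) ED. 11: (LBGL-2b) `sig_K2E3GL2RegularNilpotentFourier` PAID BY NAME   [ED. 11]
import Summits.HodgeConjecture.HodgeConjecture.Theorems.K2E3GL2NilpotentOneOrbitUniqueness                -- ★ p857002 (K2E3-p12 g4) ED. 13: (LBGL-2a) `sig_K2E3GL2NilpotentStructure` PAID BY NAME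
import Summits.HodgeConjecture.HodgeConjecture.Theorems.K2E3U2NilpotentFourierRegularOfGL2                 -- ★ p857300 (K2E3-p12 g4) ED. 14: (L-B_U)′ at `N = 2` ⟸ (LBU-2⁺)
import Summits.HodgeConjecture.HodgeConjecture.Theorems.K2E3U01NilpotentFourierRegular                       -- ★ p857435∕p857440 (K2E3-p14 g4) ED. 14: (LBU-01) `sig_K2E3UNilpotentFourierRegularLeOne` PAID BY NAME
import Summits.HodgeConjecture.HodgeConjecture.Theorems.K2E3GL2NmNilpotentFourierRegularOfTwistedLocal      -- ★ p857555 (K2E3-p12 g5) ED. 14: (LBU-2⁺) ⟸ (LBGL-2b-Tw)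
import Summits.HodgeConjecture.HodgeConjecture.Theorems.K2E3GL3NilpotentFourierRegularOfSliceDensities    -- ★ p857562∕p857575 (K2E3-p20 g5) ED. 16: (LBGL-ge3) at `N = 3` ⟸ (LBGL-3E) + (LBGL-3J)
import Summits.HodgeConjecture.HodgeConjecture.Theorems.K2E3NormalizedCharBddNearSingularDescentLeTwo    -- ★ (K2E3-p12 g5) ED. 16: (12D-le2) PAID BY NAME
import Summits.HodgeConjecture.HodgeConjecture.Theorems.K2E3GL2TwistedRegularNilpotentFourier    -- ★ p857728 (K2E3-p12 g5) ED. 17: (LBGL-2b-Tw) PAID BY NAME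
import Summits.HodgeConjecture.HodgeConjecture.Theorems.K2E3GL3BorelSliceDensity    -- ★ p857955 (K2E3-p17 g6) ED. 18: (LBGL-3J) PAID BY NAME (by application)
import Summits.HodgeConjecture.HodgeConjecture.Theorems.K2E3GL3ParabolicSliceDensity    -- ★ p858128 (K2E3-p11 g5) ED. 20: (LBGL-3E) PAID BY NAME (by application)
import Summits.HodgeConjecture.HodgeConjecture.Theorems.K2E3GL3SupercuspidalCharLocInt    -- ★ B6-final p857950 (K2E3-p23 g5) ED. 19: (11-3-split-sc) ⟸ (11-3-split-sc-NE)
import Summits.HodgeConjecture.HodgeConjecture.Theorems.K2E3GL3ModUniformizerNonEllEstimates    -- ★ p858635 (K2E3-p23 g5) ED. 22: (11-3-split-sc-NE) PAID BY NAME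
import Summits.HodgeConjecture.HodgeConjecture.Theorems.K2E3CharLocIntNearSplitSupercuspidalTransport    -- ★ B6-T p857857 (K2E3-p23 g5)
import Literature.NumberTheory.Automorphic.AnisotropicUnitaryGroupCompactLocal    -- ★ `exists_v_eq_exp_neg_one_adicCompletion` (uniformizer of `L_w`)
import Summits.HodgeConjecture.HodgeConjecture.Theorems.K2E3CharLocIntNearSplitNonSupercuspidalTransport    -- ★ (nsc-T) p858454 (K2E3-p03 g5) ED. 21: (11-3-split-nsc) ⟸ {(nsc-S-A′), (nsc-S-C′)}
import Summits.HodgeConjecture.HodgeConjecture.Theorems.K2E3CharLocIntNearParabolicIndOfAC    -- ★ (nsc-vD-gen) p858529 (K2E3-p11 g6) ED. 21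
import Summits.HodgeConjecture.HodgeConjecture.Theorems.K2E3CharLocIntNearLinearCombination    -- ★ (nsc-LC) p858540 (K2E3-p11 g6) ED. 21
import Summits.HodgeConjecture.HodgeConjecture.Theorems.K2E3GL3ParabolicKMUAbsCont    -- ★ (AC-P₂₁) p858599 (K2E3-p11 g6) ED. 21: `parabolicKMU_null_of_haar_null`
import Summits.HodgeConjecture.HodgeConjecture.Theorems.K2E3GL3BorelKMUAbsCont    -- ★ (AC-B) p858590 (K2E3-p17 g7) ED. 21: `borelKMU_absolutelyContinuous`
import Literature.NumberTheory.Automorphic.ParabolicInductionSupercuspidalProofs    -- ★ `isSupercuspidal_iff_jacquetGL_holds` (Harish-Chandra criterion) ED. 21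
import Summits.HodgeConjecture.HodgeConjecture.Theorems.K2E3FinConjPlaceOfFinConj   -- ED. 12 (FC re-point)
import Literature.NumberTheory.Automorphic.IrreducibleClassesConstituents                               -- ★ ED. 10: `IrrClass.isConstituentOf_iff_eq_mk`   [ED. 10]

/-!
# K2_E3_EllipticInputs ∕ U12Characters — PART «LIE» (ED. 23 byte-cap split of `Lines/K2_E3_EllipticInputsSigs_U12Characters.lean`; SAME namespace
`Summit.HodgeConjecture.HodgeConjecture.Cruxes.H413.K2E3EllipticInputs.U12Characters`, every FQ name unchanged; the HEADER OF RECORD, the editions log, the accounting and the tier-0 compositions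
`charLocInt_of_sigs` ∕ `charLocBdd_of_sigs` stay in the main module, which imports this one).

CONTENT (moved VERBATIM from U12 ED. 22 6dcdedb5b2b1cb10, lines ≈792–1387; statement bytes FROZEN since their hosting editions ED. 7∕8∕13∕14∕16∕17∕18∕20; dealer K2E3-plan (g4),
2026-09-04 ≈09:10Z; generator `K2/K2E3-plan/g4/mk_u12_ed23.py` asserts every `theorem` statement byte-identical across the pair): §L the five HOSTED LIE-CORE SOCKETS under U12-d₁
(K2E3-p12 (g3) SUBSIGS v3 ac7d1d12b136db49) and everything re-tied beneath them —
* (L-A_GL) `sig_K2E3GLnLieCharExpansionAtOne` OPEN XL [HC1999 Thm 16.3 ∕ Howe1974];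
* §L-bis (L-B_GL) `sig_K2E3GLnNilpotentFourierRegular` REL over EXACTLY {(LBGL-ge4) `sig_K2E3GLnNilpotentFourierRegularGeFour` OPEN XL} — (LBGL-2a) ★ p857002, (LBGL-2b) ★ p857214, (LBGL-3J) ★ p857955,
  (LBGL-3E) ★ p858128, (LBGL-ge3) `sig_K2E3GLnNilpotentFourierRegularGeThree` rel-tied by `N = 3 ∣ N ≥ 4`, `glnNilpotentFourierRegular_zero` (sorry-free);
* (L-A_U)′ `sig_K2E3ULieCharExpansionAtOne` OPEN XL; (L-B_U)′ `sig_K2E3UNilpotentFourierRegular` REL over EXACTLY {(LBU-ge3) `sig_K2E3UNilpotentFourierRegularGeThree` OPEN XL} —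
  (LBU-le1) ★ p857435∕p857440, (LBGL-2b-Tw) ★ p857728, (LBU-2⁺) ★ p857555;
* (12-D) `sig_K2E3NormalizedCharBddNearSingularDescent` REL over EXACTLY {(12D-ge3) `sig_K2E3NormalizedCharBddNearSingularDescentGeThree` OPEN} — (12D-le2) ★ (K2E3-p12 g5).
Sorries in THIS file = 5 = {(L-A_GL), (LBGL-ge4), (L-A_U)′, (LBU-ge3), (12D-ge3)}; the main module keeps 5 = {(SC-an) idle, (11-N≠3), (nsc-S-A′), (nsc-S-C′), (11-3ns-res)}; U12 total 10 (unchanged by the split).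
Imports = the U12 ED. 22 import block VERBATIM (a superset of what §L needs; all ★, all oleans on the hub).  Payers never import `Lines`; they conclude a socket BY NAME from `Theorems/…`.

§ EDITIONS (this PART).  ED. 1 (K2E3-plan g4, 2026-09-04 ≈09:10Z): created by the split; no statement, body or docstring byte of the moved blocks changed.

HONEST LABEL: HC_CM is proved only modulo the 7 printed citations (2 remaining named inputs: hLiu418 = stmt-HodgeConjecture-24832, h413 = stmt-HodgeConjecture-24833) until rung 0 closes; REL ≠ ★. -/

noncomputable section

open NumberField IsDedekindDomain MeasureTheory
open scoped Matrix MatrixGroups Valued NNReal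
open Literature.NumberTheory.Rogawski1990 Literature.NumberTheory.Automorphic Literature.NumberTheory.Automorphic.UnitaryGroup
open Literature.NumberTheory.Automorphic.UnitaryGroup.CotangentForms Literature.NumberTheory.GaloisRepresentations
open Literature.NumberTheory.Automorphic.Arthur2013.Leaves.TECR
open Summit.HodgeConjecture.HodgeConjecture.Cruxes.H413.F0P3cStCharTSPaydown

namespace Summit.HodgeConjecture.HodgeConjecture.Cruxes.H413.K2E3EllipticInputs.U12Characters

/-! ## §L (ED. 7) — HOSTED LIE-CORE SOCKETS under U12-d₁ (K2E3-p12 (g3) SUBSIGS v3 ac7d1d12b136db49; R15: K2E3-r01 (g2) PRE-BOX PASS 01:37:03Z)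

Five OPEN sockets — (L-A_GL) `sig_K2E3GLnLieCharExpansionAtOne` [HC1999 Thm 16.3 ∕ Howe1974], (L-B_GL) `sig_K2E3GLnNilpotentFourierRegular` [HC1999 Thm 4.4], (L-A_U)′ `sig_K2E3ULieCharExpansionAtOne`,
(L-B_U)′ `sig_K2E3UNilpotentFourierRegular` (both with the repaired antecedent `(∃ a, galAdicCompletionMap (L := L) (IsCMField.complexConj L) hw a = a ∧ ψ a ≠ 1) →` of ruling R-a:
the v2 text was refuted by K2E3-r01 (g2) `K2/K2E3-r01/g2/Refute_LBU.K2E3-r01-g2.lean` 72b16d72c9ece906 — ψ trivial on the fixed field — class misstated, repaired C′ (a); the antecedent is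
discharged by ★ p856471 `IsCMField.exists_fixed_adeleAddCharAt_ne_one`), (12-D) `sig_K2E3NormalizedCharBddNearSingularDescent` [HC1999 §§14–16 descent] — whose conjunction with U12-g pays
U12-d₁ `sig_K2E3NormalizedCharBddOnCayleySlice` BY NAME through ★ `Theorems/K2E3NormalizedCharBddOnCayleySliceOfLieCoreFixed.lean` (K2E3-p12 (g3); over ★ p856314 capstone + ★ p856471).
The `open … in` line on each block re-creates the SUBSIGS file's ambient opens; the tie term of U12-d₁ is the kernel certificate that the hosted bytes elaborate to the capstone's binders. -/

set_option maxHeartbeats 1600000 in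
set_option synthInstance.maxHeartbeats 400000 in
open scoped Classical in
open MeasureTheory.Measure Filter Topology Polynomial Literature.NumberTheory.GaloisRepresentations.IsNonarchimedeanLocalField Summit.HodgeConjecture.HodgeConjecture.Cruxes.H413.K2E3LieUnitary in
/-- **(L-A_GL)** local character expansion at `1` of `GL_N(F)` in `T̂`-form through the Cayley chart. [cite: HarishChandra1999AdmissibleDistributions, Thm. 16.3 p. 77] [cite: Howe1974, Prop. 3, Lemma 4] 
ED. 7 (K2E3-plan g2, 2026-09-04): HOSTED SOCKET (L-A_GL) — statement bytes = K2E3-p12 (g3) `K2/K2E3-p12/g3/SUBSIGS-U12d-LieCore.v3.K2E3-p12-g3.lean` sha16 ac7d1d12b136db49 `subsig_K2E3GLnLieCharExpansionAtOne` VERBATIM (`subsig_` ↦ `sig_`); K2E3-r01 (g2) PRE-BOX PASS FIX 0 01:37:03Z. OPEN (payer files `Theorems/…lean --supports stmt-HodgeConjecture-24833 --as helper`, never importing `Lines`). -/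
theorem sig_K2E3GLnLieCharExpansionAtOne :
    ∀ (F : Type) [Field F] [ValuativeRel F] [TopologicalSpace F] [IsNonarchimedeanLocalField F] [CharZero F] (N : ℕ)
      (ψ : AddChar F Circle), ψ.IsContinuousNontrivial →
      ∀ [MeasurableSpace (Matrix (Fin N) (Fin N) F)] [BorelSpace (Matrix (Fin N) (Fin N) F)] (μ𝔤 : Measure (Matrix (Fin N) (Fin N) F)) [μ𝔤.IsAddHaarMeasure]
        [MeasurableSpace (GL (Fin N) F)] [BorelSpace (GL (Fin N) F)] (μ₀ : Measure (GL (Fin N) F)) [μ₀.IsHaarMeasure]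
        (r₀ : SmoothIrrep (GL (Fin N) F)), r₀.ρ.IsAdmissible → ∀ Θ₀ : GL (Fin N) F → ℂ,
        (∀ x₀ : GL (Fin N) F, IsRegularElt x₀ → ∀ᶠ y in 𝓝 x₀, Θ₀ y = Θ₀ x₀) →
        (∀ φ₀ : GL (Fin N) F → ℂ, IsLocSmooth φ₀ → (IrrClass.mk r₀).smoothTrace μ₀ φ₀ = ∫ x, φ₀ x * Θ₀ x ∂μ₀) →
      ∃ V : Set (Matrix (Fin N) (Fin N) F), V ∈ 𝓝 (0 : Matrix (Fin N) (Fin N) F) ∧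
      ∃ T : (Matrix (Fin N) (Fin N) F → ℂ) → ℂ,
        ((∀ f₁ f₂ : Matrix (Fin N) (Fin N) F → ℂ, IsLocSmooth f₁ → IsLocSmooth f₂ → T (f₁ + f₂) = T f₁ + T f₂) ∧
         (∀ (a : ℂ) (f : Matrix (Fin N) (Fin N) F → ℂ), IsLocSmooth f → T (a • f) = a * T f) ∧
         (∀ (x : GL (Fin N) F) (f : Matrix (Fin N) (Fin N) F → ℂ), IsLocSmooth f →
            T (fun X => f ((x : Matrix (Fin N) (Fin N) F) * X * ((x⁻¹ : GL (Fin N) F) : Matrix (Fin N) (Fin N) F))) = T f) ∧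
         (∀ f : Matrix (Fin N) (Fin N) F → ℂ, IsLocSmooth f → (∀ X ∈ tsupport f, ¬ IsNilpotent X) → T f = 0)) ∧
        ∀ Fn : Matrix (Fin N) (Fin N) F → ℂ,
          (∀ f : Matrix (Fin N) (Fin N) F → ℂ, IsLocSmooth f →
              T (fun Y => ∫ X, ((ψ (Matrix.trace (Y * X)) : Circle) : ℂ) * f X ∂μ𝔤) = ∫ X, f X * Fn X ∂μ𝔤) →
          (∀ X : Matrix (Fin N) (Fin N) F, IsUnit X.charpoly.discr → ∀ᶠ Y in 𝓝 X, Fn Y = Fn X) →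
          ∀ g : GL (Fin N) F, ∀ Y ∈ V, IsUnit Y.charpoly.discr → IsUnit (1 - Y) → IsUnit (1 + Y) →
            (g : Matrix (Fin N) (Fin N) F) = (1 + Y) * (1 - Y)⁻¹ → Θ₀ g = Fn Y := by
  sorry

/-! ## ED. 8 §L-bis — RESIDUAL LEAVES OF (L-B_GL) BY `N` (dealer cand `K2/K2E3-plan/g2/U12_LBGL_leaves.cand.v1.K2E3-plan-g2.lean` sha16 331b99376c0d3cd6, K2E3-p12 (g3) 02:41:10Z names): (LBGL-2a) structure of `J(𝒩)(𝔤𝔩₂)`,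
(LBGL-2b) regularity of `μ̂_reg`, (LBGL-ge3) `N ≥ 3`; `N = 0` proved; (L-B_GL) below is RE-TIED REL over them (R14 (β)). Count-neutral sub-leaves until :(L-B_GL) closes. -/

set_option maxHeartbeats 1600000 in
set_option synthInstance.maxHeartbeats 400000 in
open scoped Classical in
open MeasureTheory.Measure Filter Topology Polynomial Literature.NumberTheory.GaloisRepresentations.IsNonarchimedeanLocalField Summit.HodgeConjecture.HodgeConjecture.Cruxes.H413.K2E3LieUnitary in
/-- **(LBGL-2a) `sig_K2E3GL2NilpotentStructure` — STRUCTURE OF `J(𝒩)(𝔤𝔩₂(F))`** (residual sub-leaf of (L-B_GL) :310 at `N = 2`; size M–L;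
owner: the §L (LBGL-2a′) road hand — K2E5-p15 (g3) S2b∕S2c after K2E3-p12 (g3)'s MEMO v2 8deb00b1; count-neutral until :310 closes).
Every distribution `T` on `C_c^∞(𝔤𝔩₂(F))` that is additive, homogeneous, `Ad(GL₂(F))`-invariant and supported on the nilpotent cone is
`a·δ₀ + b·μ_reg`, where `μ_reg(f) = ∫_{GL₂(𝒪_F) × F} f(k · tE₁₂ · k⁻¹) d(κ ⊗ dx)` is the regular nilpotent orbital integral for a Haar pair
`(κ, dx)` (★ p856734: `μ_reg ∈ J(𝒩) ∖ ℂδ₀`).  By ★ p856851 `gl2_nilpotentStructure_of_puncturedCone` it follows from the one-orbit uniqueness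
(LBGL-2a′) «`∃ c, ∀ f, IsLocSmooth f → 0 ∉ tsupport f → T f = c·μ_reg(f)`» (kernel road: ★ COINV-1, Glimm–Effros, ★ p856878).
[cite: HarishChandra1999AdmissibleDistributions, §3 Thm. 3.9, Cor. 3.10 p. 10 (`dim J(𝒩)` = number of nilpotent orbits = 2 for `𝔤𝔩₂`)]
[cite: Howe1974, Prop. 3]
ED. 13 (K2E3-plan g3, 2026-09-04 ≈04:50Z): **TIED ★ BY NAME** `:= @…K2E3GL2NilpotentOneOrbitUniqueness.gl2_nilpotentStructure` (★ p857002 S2c over ★ p856983 S2b, K2E3-p12 (g4); probe `K2/K2E3-p12/g4/probes/ProbeTie_LBGL2a.K2E3-p12-g4.lean` GREEN 03:37Z; §L lead ping 04:43:05Z).  STATE: ★. -/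
theorem sig_K2E3GL2NilpotentStructure :
    ∀ (F : Type) [Field F] [ValuativeRel F] [TopologicalSpace F] [IsNonarchimedeanLocalField F] [CharZero F]
      [MeasurableSpace F] [BorelSpace F] [MeasurableSpace (GL (Fin 2) F)] [BorelSpace (GL (Fin 2) F)]
      (κ : Measure ↥(glInt 2 F)) [IsHaarMeasure κ] (dx : Measure F) [dx.IsAddHaarMeasure],
      ∀ T : (Matrix (Fin 2) (Fin 2) F → ℂ) → ℂ,
        ((∀ f₁ f₂ : Matrix (Fin 2) (Fin 2) F → ℂ, IsLocSmooth f₁ → IsLocSmooth f₂ → T (f₁ + f₂) = T f₁ + T f₂) ∧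
         (∀ (a : ℂ) (f : Matrix (Fin 2) (Fin 2) F → ℂ), IsLocSmooth f → T (a • f) = a * T f) ∧
         (∀ (x : GL (Fin 2) F) (f : Matrix (Fin 2) (Fin 2) F → ℂ), IsLocSmooth f →
            T (fun X => f ((x : Matrix (Fin 2) (Fin 2) F) * X * ((x⁻¹ : GL (Fin 2) F) : Matrix (Fin 2) (Fin 2) F))) = T f) ∧
         (∀ f : Matrix (Fin 2) (Fin 2) F → ℂ, IsLocSmooth f → (∀ X ∈ tsupport f, ¬ IsNilpotent X) → T f = 0)) →
        ∃ a b : ℂ, ∀ f : Matrix (Fin 2) (Fin 2) F → ℂ, IsLocSmooth f →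
          T f = a * f 0 + b * ∫ p : ↥(glInt 2 F) × F, f (((p.1 : GL (Fin 2) F) : Matrix (Fin 2) (Fin 2) F) * !![0, p.2; 0, 0] *
            ((((p.1 : GL (Fin 2) F))⁻¹ : GL (Fin 2) F) : Matrix (Fin 2) (Fin 2) F)) ∂(κ.prod dx) :=
  @Summit.HodgeConjecture.HodgeConjecture.Cruxes.H413.K2E3GL2NilpotentOneOrbitUniqueness.gl2_nilpotentStructure

set_option maxHeartbeats 1600000 in
set_option synthInstance.maxHeartbeats 400000 in
open scoped Classical in
open MeasureTheory.Measure Filter Topology Polynomial Literature.NumberTheory.GaloisRepresentations.IsNonarchimedeanLocalField Summit.HodgeConjecture.HodgeConjecture.Cruxes.H413.K2E3LieUnitary in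
/-- **(LBGL-2b) `sig_K2E3GL2RegularNilpotentFourier` — REGULARITY OF `μ̂_reg` ON `𝔤𝔩₂(F)`** (residual sub-leaf of (L-B_GL) :310 at `N = 2`; size XL;
road: (b-i) line Fourier inversion «`μ_reg(𝓕_ψ f) = c ∫_K ∫_𝔟 f(Ad(k)B) dB dk`» UN-OWNED + (b-ii) the Lie–Weyl integration formula for `K × 𝔟 → 𝔤`;
inputs ★ p856597 (`|disc|^{-1/2}` is `L¹_loc`), ★ p856815 (`Ad K`), ★ Tate `fourierSB_fourierSB_eq`; count-neutral until :310 closes).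
The Fourier transform of the regular nilpotent orbital integral `μ_reg` (Haar pair `(κ, dx)`, additive character `ψ`, self-dual-or-any Haar `μ𝔤`) is
represented by a locally integrable function `F_reg`, locally constant on `{disc χ ≠ 0}`, with `|disc χ|_F^{1/2}·|F_reg|` locally bounded
(classically `F_reg(Y) = c·|disc χ_Y|_F^{-1/2}` on split regular semisimple `Y`, `0` on elliptic `Y`).
[cite: HarishChandra1999AdmissibleDistributions, Thm. 4.4 p. 11 (for `μ_reg`), Lemma 7.8] [cite: Howe1974, Prop. 3]
ED. 11 (K2E3-plan g3, 2026-09-04 ≈04:10Z): **TIED ★ BY NAME** `:= @…K2E3GL2RegularNilpotentFourier.gl2RegularNilpotentFourier` (★ p857214 `Theorems/K2E3GL2RegularNilpotentFourier.lean`, K2E5-p10 (g4) 04:02:09Z — conclusion == these bytes VERBATIM; chain by name: (b-i) ★ p856988 → assembly ★ p857004 `…OfSliceDensity` → (Q) ★ p857064∕p857076 → (LC) ★ p857112 → (A) ★ p857069∕p857099 (K2E5-p17 (g3)) → (b-ii) ★ p857186 `exists_borelSliceDensity` (K2E5-p10 (g4)); §L lead K2E3-p12 (g4); probe `K2/K2E3-plan/g3/probes/Probe_TieLBGL2b.lean`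 rc 0).  STATE: ★. -/
theorem sig_K2E3GL2RegularNilpotentFourier :
    ∀ (F : Type) [Field F] [ValuativeRel F] [TopologicalSpace F] [IsNonarchimedeanLocalField F] [CharZero F]
      (ψ : AddChar F Circle), ψ.IsContinuousNontrivial →
      ∀ [MeasurableSpace (Matrix (Fin 2) (Fin 2) F)] [BorelSpace (Matrix (Fin 2) (Fin 2) F)] (μ𝔤 : Measure (Matrix (Fin 2) (Fin 2) F)) [μ𝔤.IsAddHaarMeasure]
        [MeasurableSpace F] [BorelSpace F] [MeasurableSpace (GL (Fin 2) F)] [BorelSpace (GL (Fin 2) F)]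
        (κ : Measure ↥(glInt 2 F)) [IsHaarMeasure κ] (dx : Measure F) [dx.IsAddHaarMeasure],
      ∃ Fr : Matrix (Fin 2) (Fin 2) F → ℂ, LocallyIntegrable Fr μ𝔤 ∧
        (∀ f : Matrix (Fin 2) (Fin 2) F → ℂ, IsLocSmooth f →
          ∫ p : ↥(glInt 2 F) × F, (fun Y : Matrix (Fin 2) (Fin 2) F => ∫ X, ((ψ (Matrix.trace (Y * X)) : Circle) : ℂ) * f X ∂μ𝔤)
              (((p.1 : GL (Fin 2) F) : Matrix (Fin 2) (Fin 2) F) * !![0, p.2; 0, 0] * ((((p.1 : GL (Fin 2) F))⁻¹ : GL (Fin 2) F) : Matrix (Fin 2) (Fin 2) F)) ∂(κ.prod dx) =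
            ∫ X, f X * Fr X ∂μ𝔤) ∧
        (∀ X : Matrix (Fin 2) (Fin 2) F, IsUnit X.charpoly.discr → ∀ᶠ Y in 𝓝 X, Fr Y = Fr X) ∧
        (∀ C : Set (Matrix (Fin 2) (Fin 2) F), IsCompact C → ∃ B : ℝ, ∀ X ∈ C,
            ((NNReal.sqrt (normAbs F X.charpoly.discr) : ℝ≥0) : ℝ) * ‖Fr X‖ ≤ B) :=
  @Summit.HodgeConjecture.HodgeConjecture.Cruxes.H413.K2E3GL2RegularNilpotentFourier.gl2RegularNilpotentFourier

set_option maxHeartbeats 1600000 in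
set_option synthInstance.maxHeartbeats 400000 in
open scoped Classical in
open MeasureTheory.Measure Filter Topology Polynomial Literature.NumberTheory.GaloisRepresentations.IsNonarchimedeanLocalField Summit.HodgeConjecture.HodgeConjecture.Cruxes.H413.K2E3LieUnitary in
open scoped ENNReal in
/-- **(LBGL-3J) `sig_K2E3GL3BorelSliceDensity` — THE BOREL SLICE DENSITY OF `𝔤𝔩₃(F)`** (leaf of (LBGL-ge3) at `N = 3`; payer K2E3-p17 (g6), D60; size L–XL):
the `K`-average of the integral over the Borel subalgebra `𝔟₃` is a locally integrable density `W_𝔟`, locally constant on the regular semisimple set, with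
`|disc χ|^{1/2}·|W_𝔟|` locally bounded (`W_𝔟 = c·#{orderings of the roots in F}·|disc χ_X|_F^{-1/2}` on the split regular set).
[cite: HarishChandra1999AdmissibleDistributions, §7, Thm. 4.4 p. 11] [cite: Howe1974, Prop. 3]
ED. 16 (K2E3-plan g3, 2026-09-04 ≈05:55Z; RULING R15): HOSTED LEAF (LBGL-3J) «split-Cartan ∕ Borel slice density of 𝔤𝔩₃(F)» — statement bytes = Richardson road owner K2E3-p11 (g4) cand `K2/K2E3-p11/g4/tie_LBGLge3.cand.v1.K2E3-p11-g4.lean` sha16 c0495825fd68c5f2 VERBATIM (r02 05:21:58Z + r01 05:22:24Z PRE-BOX PASS; conclusion == K2E3-p17 (g6) frozen head 05:05:36Z; binder order = ★ glue `variable` order — payer ties BY APPLICATION).  Payer: (D60) K2E3-p17 (g6) `K2E3GL3BorelSliceDensity.exists_borelSliceDensity`.  STATE: OPEN.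
ED. 18 (K2E3-plan g3, 2026-09-04 ≈06:40Z): **★-TIED BY APPLICATION** `:= fun F _ _ _ _ _ _ μ𝔤 _ _ _ _ _ κ _ dx _ => …K2E3GL3BorelSliceDensity.exists_borelSliceDensity μ𝔤 κ dx` — ★ p857955 (K2E3-p17 (g6), (F-J)∕D60 HEAD; chain E1 p857621 · E2 p857634 · G1 p857658 · F1 p857680 · F2a p857717 · F2b p857738 · G2 p857756 · I p857802 · H1a p857820 · H1b p857852 · H1c p857878 · H2a p857916 · HEAD p857955, 13 files ∕ 0 bounces; `W = c·1[disc χ ≠ 0 ∧ 3 roots in F]·(√‖disc χ‖)⁻¹`).  STATE: ★-tied.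
ED. 19: body binder `fun F` ↦ `fun _` (K2E3-r01 (g3) 06:36:32Z NIT — unused-variable linter; statement bytes untouched). -/
theorem sig_K2E3GL3BorelSliceDensity :
    ∀ (F : Type) [Field F] [ValuativeRel F] [TopologicalSpace F] [IsNonarchimedeanLocalField F]
      [MeasurableSpace (Matrix (Fin 3) (Fin 3) F)] [BorelSpace (Matrix (Fin 3) (Fin 3) F)] (μ𝔤 : Measure (Matrix (Fin 3) (Fin 3) F)) [μ𝔤.IsAddHaarMeasure]
      [MeasurableSpace F] [BorelSpace F] [MeasurableSpace (GL (Fin 3) F)] [BorelSpace (GL (Fin 3) F)]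
      (κ : Measure ↥(glInt 3 F)) [IsHaarMeasure κ] (dx : Measure F) [dx.IsAddHaarMeasure],
      ∃ W : Matrix (Fin 3) (Fin 3) F → ℂ, LocallyIntegrable W μ𝔤 ∧
        (∀ f : Matrix (Fin 3) (Fin 3) F → ℂ, IsLocSmooth f →
          ∫ k : ↥(glInt 3 F), ∫ r : Fin 6 → F,
              f (((k : GL (Fin 3) F) : Matrix (Fin 3) (Fin 3) F) * !![r 0, r 1, r 2; 0, r 3, r 4; 0, 0, r 5] *
                ((((k : GL (Fin 3) F))⁻¹ : GL (Fin 3) F) : Matrix (Fin 3) (Fin 3) F)) ∂(Measure.pi fun _ : Fin 6 => dx) ∂κ = ∫ X, f X * W X ∂μ𝔤) ∧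
        (∀ X : Matrix (Fin 3) (Fin 3) F, IsUnit X.charpoly.discr → ∀ᶠ Y in 𝓝 X, W Y = W X) ∧
        (∀ C : Set (Matrix (Fin 3) (Fin 3) F), IsCompact C → ∃ B : ℝ, ∀ X ∈ C,
            ((NNReal.sqrt (normAbs F X.charpoly.discr) : ℝ≥0) : ℝ) * ‖W X‖ ≤ B) :=
  fun _ _ _ _ _ _ _ μ𝔤 _ _ _ _ _ κ _ dx _ =>
    Summit.HodgeConjecture.HodgeConjecture.Cruxes.H413.K2E3GL3BorelSliceDensity.exists_borelSliceDensity μ𝔤 κ dx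

set_option maxHeartbeats 1600000 in
set_option synthInstance.maxHeartbeats 400000 in
open scoped Classical in
open MeasureTheory.Measure Filter Topology Polynomial Literature.NumberTheory.GaloisRepresentations.IsNonarchimedeanLocalField Summit.HodgeConjecture.HodgeConjecture.Cruxes.H413.K2E3LieUnitary in
open scoped ENNReal in
/-- **(LBGL-3E) `sig_K2E3GL3ParabolicSliceDensity` — THE `(2,1)`-PARABOLIC SLICE DENSITY OF `𝔤𝔩₃(F)`** (leaf of (LBGL-ge3) at `N = 3`; payer K2E3-p11 (g4);
size XL): the `K`-average of the integral over the maximal parabolic subalgebra `𝔭_{(2,1)} = {Y | Y₂₀ = Y₂₁ = 0}` is a locally integrable density `W_𝔭`,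
locally constant on the regular semisimple set, with `|disc χ|^{1/2}·|W_𝔭|` locally bounded (`W_𝔭(X) = c·Σ_{λ ∈ F, χ_X(λ) = 0} |χ_X′(λ)|_F⁻¹`).
[cite: HarishChandra1999AdmissibleDistributions, §7, Thm. 4.4 p. 11] [cite: Howe1974, Prop. 3]
ED. 16 (K2E3-plan g3): HOSTED LEAF (LBGL-3E) «(2,1)-parabolic slice density of 𝔤𝔩₃(F)» — statement bytes = same cand c0495825 VERBATIM (pre-boxed).  Payer: (F-E) K2E3-p11 (g5) (E′ → G′ → H′, MEMO-FE 9ecb0fc6) ∕ K2E3-p21 (g4).  STATE: OPEN.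
ED. 20 (K2E3-plan g3, 2026-09-04 ≈07:10Z): **★-TIED BY APPLICATION** `:= fun _ _ _ _ _ _ _ μ𝔤 _ _ _ _ _ κ _ dx _ => …K2E3GL3ParabolicSliceDensity.exists_parabolicSliceDensity μ𝔤 κ dx` — ★ p858128 (K2E3-p11 (g5), (F-E) road v2: E″1 p857732 · E″2 p857776 · G″1 p857840 · G″2 p857881(+kit p858138) · H″1 p857909 · H″2 p857927 · H″3a p857956 · H″3b p857991 · H″6a p858007 · H″6 p858083 · H″7 p858128, with hands K2E3-p21 (g4) A′2∕D′∕TwistForm∕EXHAUST, K2E3-p03 (g4) S″∕P″∕W-BOUND, K2E5-p17 (g4) F″, K2E3-p17 (g6) H″4; `W_𝔭 = c·Σ_{λ∈F, χ_X(λ)=0} ‖χ_X′(λ)‖⁻¹`); K2E3-r02 (g4) text cert 07:03:23Z (conclusion sha12 7c7a600d6ece = socket).  STATE: ★-tied. -/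
theorem sig_K2E3GL3ParabolicSliceDensity :
    ∀ (F : Type) [Field F] [ValuativeRel F] [TopologicalSpace F] [IsNonarchimedeanLocalField F]
      [MeasurableSpace (Matrix (Fin 3) (Fin 3) F)] [BorelSpace (Matrix (Fin 3) (Fin 3) F)] (μ𝔤 : Measure (Matrix (Fin 3) (Fin 3) F)) [μ𝔤.IsAddHaarMeasure]
      [MeasurableSpace F] [BorelSpace F] [MeasurableSpace (GL (Fin 3) F)] [BorelSpace (GL (Fin 3) F)]
      (κ : Measure ↥(glInt 3 F)) [IsHaarMeasure κ] (dx : Measure F) [dx.IsAddHaarMeasure],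
      ∃ W : Matrix (Fin 3) (Fin 3) F → ℂ, LocallyIntegrable W μ𝔤 ∧
        (∀ f : Matrix (Fin 3) (Fin 3) F → ℂ, IsLocSmooth f →
          ∫ k : ↥(glInt 3 F), ∫ r : Fin 7 → F,
              f (((k : GL (Fin 3) F) : Matrix (Fin 3) (Fin 3) F) * !![r 0, r 1, r 2; r 3, r 4, r 5; 0, 0, r 6] *
                ((((k : GL (Fin 3) F))⁻¹ : GL (Fin 3) F) : Matrix (Fin 3) (Fin 3) F)) ∂(Measure.pi fun _ : Fin 7 => dx) ∂κ = ∫ X, f X * W X ∂μ𝔤) ∧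
        (∀ X : Matrix (Fin 3) (Fin 3) F, IsUnit X.charpoly.discr → ∀ᶠ Y in 𝓝 X, W Y = W X) ∧
        (∀ C : Set (Matrix (Fin 3) (Fin 3) F), IsCompact C → ∃ B : ℝ, ∀ X ∈ C,
            ((NNReal.sqrt (normAbs F X.charpoly.discr) : ℝ≥0) : ℝ) * ‖W X‖ ≤ B) :=
  fun _ _ _ _ _ _ _ μ𝔤 _ _ _ _ _ κ _ dx _ =>
    Summit.HodgeConjecture.HodgeConjecture.Cruxes.H413.K2E3GL3ParabolicSliceDensity.exists_parabolicSliceDensity μ𝔤 κ dx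

set_option maxHeartbeats 1600000 in
set_option synthInstance.maxHeartbeats 400000 in
open scoped Classical in
open MeasureTheory.Measure Filter Topology Polynomial Literature.NumberTheory.GaloisRepresentations.IsNonarchimedeanLocalField Summit.HodgeConjecture.HodgeConjecture.Cruxes.H413.K2E3LieUnitary in
open scoped ENNReal in
/-- **(LBGL-ge4) `sig_K2E3GLnNilpotentFourierRegularGeFour` — (L-B_GL) FOR `N ≥ 4`** (residual leaf of (LBGL-ge3) :623 = its body under `4 ≤ N`; size XL;
NO kernel road: the general Harish-Chandra regularity theorem for nilpotent distributions on `𝔤𝔩_N`; count-neutral; the tier-0 organ instantiates (L-B_GL)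
only at `N ≤ 3`).  [cite: HarishChandra1999AdmissibleDistributions, Thm. 4.4 p. 11, Thm. 3.9, Cor. 3.10] [cite: Howe1974, Prop. 3]
ED. 16 (K2E3-plan g3): HOSTED LEAF (LBGL-ge4) — statement = (LBGL-ge3) text with `4 ≤ N` (same cand, pre-boxed: single edit `3 ≤ N →` ↦ `4 ≤ N →`); OPEN, XL, unroaded residual.  STATE: OPEN. -/
theorem sig_K2E3GLnNilpotentFourierRegularGeFour :
    ∀ (F : Type) [Field F] [ValuativeRel F] [TopologicalSpace F] [IsNonarchimedeanLocalField F] [CharZero F] (N : ℕ), 4 ≤ N →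
      ∀ (ψ : AddChar F Circle), ψ.IsContinuousNontrivial →
      ∀ [MeasurableSpace (Matrix (Fin N) (Fin N) F)] [BorelSpace (Matrix (Fin N) (Fin N) F)] (μ𝔤 : Measure (Matrix (Fin N) (Fin N) F)) [μ𝔤.IsAddHaarMeasure],
      ∀ T : (Matrix (Fin N) (Fin N) F → ℂ) → ℂ,
        ((∀ f₁ f₂ : Matrix (Fin N) (Fin N) F → ℂ, IsLocSmooth f₁ → IsLocSmooth f₂ → T (f₁ + f₂) = T f₁ + T f₂) ∧
         (∀ (a : ℂ) (f : Matrix (Fin N) (Fin N) F → ℂ), IsLocSmooth f → T (a • f) = a * T f) ∧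
         (∀ (x : GL (Fin N) F) (f : Matrix (Fin N) (Fin N) F → ℂ), IsLocSmooth f →
            T (fun X => f ((x : Matrix (Fin N) (Fin N) F) * X * ((x⁻¹ : GL (Fin N) F) : Matrix (Fin N) (Fin N) F))) = T f) ∧
         (∀ f : Matrix (Fin N) (Fin N) F → ℂ, IsLocSmooth f → (∀ X ∈ tsupport f, ¬ IsNilpotent X) → T f = 0)) →
        ∃ Fn : Matrix (Fin N) (Fin N) F → ℂ, LocallyIntegrable Fn μ𝔤 ∧
          (∀ f : Matrix (Fin N) (Fin N) F → ℂ, IsLocSmooth f →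
              T (fun Y => ∫ X, ((ψ (Matrix.trace (Y * X)) : Circle) : ℂ) * f X ∂μ𝔤) = ∫ X, f X * Fn X ∂μ𝔤) ∧
          (∀ X : Matrix (Fin N) (Fin N) F, IsUnit X.charpoly.discr → ∀ᶠ Y in 𝓝 X, Fn Y = Fn X) ∧
          (∀ C : Set (Matrix (Fin N) (Fin N) F), IsCompact C → ∃ B : ℝ, ∀ X ∈ C,
              ((NNReal.sqrt (normAbs F X.charpoly.discr) : ℝ≥0) : ℝ) * ‖Fn X‖ ≤ B) := by
  sorry

set_option maxHeartbeats 1600000 in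
set_option synthInstance.maxHeartbeats 400000 in
open scoped Classical in
open MeasureTheory.Measure Filter Topology Polynomial Literature.NumberTheory.GaloisRepresentations.IsNonarchimedeanLocalField Summit.HodgeConjecture.HodgeConjecture.Cruxes.H413.K2E3LieUnitary in
/-- **(LBGL-ge3) `sig_K2E3GLnNilpotentFourierRegularGeThree` — (L-B_GL) FOR `N ≥ 3`** (residual leaf of :310 = the socket's body under `3 ≤ N`;
size XL; NO kernel road (the general Harish-Chandra regularity theorem for nilpotent distributions on `𝔤𝔩_N`); count-neutral until :310 closes;
the tier-0 organ instantiates (L-B_GL) only at `N ≤ 3`, so `N = 3` is the one load-bearing instance of this leaf).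
[cite: HarishChandra1999AdmissibleDistributions, Thm. 4.4 p. 11, Thm. 3.9, Cor. 3.10] [cite: Howe1974, Prop. 3]
ED. 16 (K2E3-plan g3, 2026-09-04 ≈05:55Z; RULING R15 to Richardson road owner K2E3-p11): **RE-TIED RELATIVELY BY `N`** (socket bytes frozen; OPEN for the count until its leaves close): `N = 3` ↦ ★ p857562∕p857575 `K2E3GL3NilpotentFourierRegularOfSliceDensities.gl3_nilpotentFourierRegular_of_sliceDensities` (K2E3-p20 (g5); structure «J(𝒩)(𝔤𝔩₃) = ℂδ₀ ⊕ ℂΛ_E ⊕ ℂΛ_J» ★ p857476 hypothesis-free inside) over the hosted leaves (LBGL-3E) `sig_K2E3GL3ParabolicSliceDensity` + (LBGL-3J) `sig_K2E3GL3BorelSliceDensity`; `4 ≤ N` ↦ (LBGL-ge4) `sig_K2E3GLnNilpotentFourierRegularGeFour`.  Body = p11 (g4) cand `tie_LBGLge3` VERBATIM (r01∕r02 PRE-BOX PASS; K2E3-p20 (g5) twin cand c183262c equivalent up to binder order — one hosted, no merge).  STATE: REL over EXACTLY {(LBGL-3E), (LBGL-3J), (LBGL-ge4)}.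
ED. 18: (LBGL-3J) ★ ⇒ (LBGL-ge3) STATE: REL over EXACTLY {(LBGL-3E), (LBGL-ge4)}.
ED. 20: (LBGL-3E) ★ ⇒ at `N = 3` the dispatch runs on ★ inputs only; (LBGL-ge3) STATE: REL over EXACTLY {(LBGL-ge4)} (XL, unroaded). -/
theorem sig_K2E3GLnNilpotentFourierRegularGeThree :
    ∀ (F : Type) [Field F] [ValuativeRel F] [TopologicalSpace F] [IsNonarchimedeanLocalField F] [CharZero F] (N : ℕ), 3 ≤ N →
      ∀ (ψ : AddChar F Circle), ψ.IsContinuousNontrivial →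
      ∀ [MeasurableSpace (Matrix (Fin N) (Fin N) F)] [BorelSpace (Matrix (Fin N) (Fin N) F)] (μ𝔤 : Measure (Matrix (Fin N) (Fin N) F)) [μ𝔤.IsAddHaarMeasure],
      ∀ T : (Matrix (Fin N) (Fin N) F → ℂ) → ℂ,
        ((∀ f₁ f₂ : Matrix (Fin N) (Fin N) F → ℂ, IsLocSmooth f₁ → IsLocSmooth f₂ → T (f₁ + f₂) = T f₁ + T f₂) ∧
         (∀ (a : ℂ) (f : Matrix (Fin N) (Fin N) F → ℂ), IsLocSmooth f → T (a • f) = a * T f) ∧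
         (∀ (x : GL (Fin N) F) (f : Matrix (Fin N) (Fin N) F → ℂ), IsLocSmooth f →
            T (fun X => f ((x : Matrix (Fin N) (Fin N) F) * X * ((x⁻¹ : GL (Fin N) F) : Matrix (Fin N) (Fin N) F))) = T f) ∧
         (∀ f : Matrix (Fin N) (Fin N) F → ℂ, IsLocSmooth f → (∀ X ∈ tsupport f, ¬ IsNilpotent X) → T f = 0)) →
        ∃ Fn : Matrix (Fin N) (Fin N) F → ℂ, LocallyIntegrable Fn μ𝔤 ∧
          (∀ f : Matrix (Fin N) (Fin N) F → ℂ, IsLocSmooth f →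
              T (fun Y => ∫ X, ((ψ (Matrix.trace (Y * X)) : Circle) : ℂ) * f X ∂μ𝔤) = ∫ X, f X * Fn X ∂μ𝔤) ∧
          (∀ X : Matrix (Fin N) (Fin N) F, IsUnit X.charpoly.discr → ∀ᶠ Y in 𝓝 X, Fn Y = Fn X) ∧
          (∀ C : Set (Matrix (Fin N) (Fin N) F), IsCompact C → ∃ B : ℝ, ∀ X ∈ C,
              ((NNReal.sqrt (normAbs F X.charpoly.discr) : ℝ≥0) : ℝ) * ‖Fn X‖ ≤ B) := by
  intro F _ _ _ _ _ N hN ψ hψ _ _ μ𝔤 _ T hT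
  rcases Nat.eq_or_lt_of_le hN with h3 | h4
  · subst h3
    haveI : T2Space F := (isLocalField F).toT2Space
    haveI : LocallyCompactSpace F := (isLocalField F).toLocallyCompactSpace
    letI : MeasurableSpace F := borel F
    haveI : BorelSpace F := ⟨rfl⟩
    letI : MeasurableSpace (GL (Fin 3) F) := borel _
    haveI : BorelSpace (GL (Fin 3) F) := ⟨rfl⟩
    haveI : LocallyCompactSpace (GL (Fin 3) F) := locallyCompactSpace_generalLinearGroup F 3
    haveI : LocallyCompactSpace ↥(glInt 3 F) := (isCompact_glInt 3 F).isClosed.locallyCompactSpace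
    exact Summit.HodgeConjecture.HodgeConjecture.Cruxes.H413.K2E3GL3NilpotentFourierRegularOfSliceDensities.gl3_nilpotentFourierRegular_of_sliceDensities ψ μ𝔤
      (haar : Measure ↥(glInt 3 F)) (addHaar : Measure F) hψ
      (sig_K2E3GL3ParabolicSliceDensity F μ𝔤 haar addHaar) (sig_K2E3GL3BorelSliceDensity F μ𝔤 haar addHaar) T hT
  · exact sig_K2E3GLnNilpotentFourierRegularGeFour F N h4 ψ hψ μ𝔤 T hT

set_option maxHeartbeats 1600000 in
set_option synthInstance.maxHeartbeats 400000 in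
open scoped Classical in
open MeasureTheory.Measure Filter Topology Polynomial Literature.NumberTheory.GaloisRepresentations.IsNonarchimedeanLocalField Summit.HodgeConjecture.HodgeConjecture.Cruxes.H413.K2E3LieUnitary in
/-- `N = 0`: `𝔤𝔩₀(F)` is a point; every `T` is `T(1)·ev`, `𝓕f = μ𝔤(univ)·f(pt)`, and `F_T := T(1)` (constant) does it. -/
theorem glnNilpotentFourierRegular_zero :
    ∀ (F : Type) [Field F] [ValuativeRel F] [TopologicalSpace F] [IsNonarchimedeanLocalField F] [CharZero F]
      (ψ : AddChar F Circle), ψ.IsContinuousNontrivial →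
      ∀ [MeasurableSpace (Matrix (Fin 0) (Fin 0) F)] [BorelSpace (Matrix (Fin 0) (Fin 0) F)] (μ𝔤 : Measure (Matrix (Fin 0) (Fin 0) F)) [μ𝔤.IsAddHaarMeasure],
      ∀ T : (Matrix (Fin 0) (Fin 0) F → ℂ) → ℂ,
        ((∀ f₁ f₂ : Matrix (Fin 0) (Fin 0) F → ℂ, IsLocSmooth f₁ → IsLocSmooth f₂ → T (f₁ + f₂) = T f₁ + T f₂) ∧
         (∀ (a : ℂ) (f : Matrix (Fin 0) (Fin 0) F → ℂ), IsLocSmooth f → T (a • f) = a * T f) ∧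
         (∀ (x : GL (Fin 0) F) (f : Matrix (Fin 0) (Fin 0) F → ℂ), IsLocSmooth f →
            T (fun X => f ((x : Matrix (Fin 0) (Fin 0) F) * X * ((x⁻¹ : GL (Fin 0) F) : Matrix (Fin 0) (Fin 0) F))) = T f) ∧
         (∀ f : Matrix (Fin 0) (Fin 0) F → ℂ, IsLocSmooth f → (∀ X ∈ tsupport f, ¬ IsNilpotent X) → T f = 0)) →
        ∃ Fn : Matrix (Fin 0) (Fin 0) F → ℂ, LocallyIntegrable Fn μ𝔤 ∧
          (∀ f : Matrix (Fin 0) (Fin 0) F → ℂ, IsLocSmooth f →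
              T (fun Y => ∫ X, ((ψ (Matrix.trace (Y * X)) : Circle) : ℂ) * f X ∂μ𝔤) = ∫ X, f X * Fn X ∂μ𝔤) ∧
          (∀ X : Matrix (Fin 0) (Fin 0) F, IsUnit X.charpoly.discr → ∀ᶠ Y in 𝓝 X, Fn Y = Fn X) ∧
          (∀ C : Set (Matrix (Fin 0) (Fin 0) F), IsCompact C → ∃ B : ℝ, ∀ X ∈ C,
              ((NNReal.sqrt (normAbs F X.charpoly.discr) : ℝ≥0) : ℝ) * ‖Fn X‖ ≤ B) := by
  intro F _ _ _ _ _ ψ hψ _ _ μ𝔤 _ T hT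
  -- the constant function `1` is locally smooth on the one-point space `𝔤𝔩₀(F)`
  haveI : Subsingleton (Matrix (Fin 0) (Fin 0) F) := inferInstance
  haveI : Finite (Matrix (Fin 0) (Fin 0) F) := Finite.of_subsingleton
  haveI : CompactSpace (Matrix (Fin 0) (Fin 0) F) := Finite.compactSpace
  have h1 : IsLocSmooth (fun _ : Matrix (Fin 0) (Fin 0) F => (1 : ℂ)) :=
    ⟨IsLocallyConstant.const 1, (isClosed_tsupport _).isCompact⟩
  refine ⟨fun _ => T (fun _ => (1 : ℂ)), ?_, ?_, ?_, ?_⟩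
  · haveI : IsFiniteMeasure μ𝔤 := CompactSpace.isFiniteMeasure
    exact (integrable_const _).locallyIntegrable
  · intro f hf
    have hf0 : f = fun _ => f 0 := funext fun X => congrArg f (Subsingleton.elim X 0)
    have htr : ∀ Y X : Matrix (Fin 0) (Fin 0) F, Matrix.trace (Y * X) = 0 := fun Y X => by
      simp [Matrix.trace]
    have hF : (fun Y : Matrix (Fin 0) (Fin 0) F => ∫ X, ((ψ (Matrix.trace (Y * X)) : Circle) : ℂ) * f X ∂μ𝔤) =
        ((μ𝔤.real Set.univ : ℂ) * f 0) • fun _ : Matrix (Fin 0) (Fin 0) F => (1 : ℂ) := by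
      funext Y
      simp only [htr, AddChar.map_zero_eq_one, Circle.coe_one, one_mul, Pi.smul_apply, smul_eq_mul, mul_one]
      rw [hf0]
      simp [integral_const, Complex.real_smul]  -- `∫ _, f 0 ∂μ𝔤 = μ𝔤.real univ • f 0`
    rw [hF, hT.2.1 _ _ h1]
    conv_rhs => rw [hf0]
    simp [integral_const, Complex.real_smul]
    ring
  · intro X _
    exact Filter.Eventually.of_forall fun _ => rfl
  · intro C _
    exact ⟨((NNReal.sqrt (normAbs F (0 : Matrix (Fin 0) (Fin 0) F).charpoly.discr) : ℝ≥0) : ℝ) * ‖T (fun _ => (1 : ℂ))‖,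
      fun X _ => by rw [Subsingleton.elim X 0]⟩

set_option maxHeartbeats 1600000 in
set_option synthInstance.maxHeartbeats 400000 in
open scoped Classical in
open MeasureTheory.Measure Filter Topology Polynomial Literature.NumberTheory.GaloisRepresentations.IsNonarchimedeanLocalField Summit.HodgeConjecture.HodgeConjecture.Cruxes.H413.K2E3LieUnitary in
/-- **(L-B_GL)** Harish-Chandra's Thm. 4.4 ∕ §21 for `J(𝒩)` on `𝔤𝔩_N(F)`. [cite: HarishChandra1999AdmissibleDistributions, Thm. 4.4 p. 11, §21 p. 87] [cite: Howe1974] 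
ED. 7 (K2E3-plan g2, 2026-09-04): HOSTED SOCKET (L-B_GL) — statement bytes = K2E3-p12 (g3) `K2/K2E3-p12/g3/SUBSIGS-U12d-LieCore.v3.K2E3-p12-g3.lean` sha16 ac7d1d12b136db49 `subsig_K2E3GLnNilpotentFourierRegular` VERBATIM (`subsig_` ↦ `sig_`); K2E3-r01 (g2) PRE-BOX PASS FIX 0 01:37:03Z. OPEN (payer files `Theorems/…lean --supports stmt-HodgeConjecture-24833 --as helper`, never importing `Lines`).
ED. 8 (K2E3-plan g2, 2026-09-04): RE-TIED RELATIVELY BY `N` (R14 (β); socket bytes frozen, stays an OPEN socket for the count until its leaves close): `N = 0` ↦ `glnNilpotentFourierRegular_zero` (proved); `N = 1` ↦ ★ p856457 `K2E3GLnNilpotentFourierPointSupport.gl1_nilpotentFourierRegular` VERBATIM; `N = 2` ↦ ★ p856788 `K2E3GL2NilpotentFourierRegularOfStructure.gl2_nilpotentFourierRegular_of_structure (κ := Measure.haar) (dx := Measure.addHaar)` over the hosted leaves (LBGL-2a) `sig_K2E3GL2NilpotentStructure` + (LBGL-2b) `sig_K2E3GL2RegularNilpotentFourier`; `N ≥ 3`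 ↦ leaf (LBGL-ge3) `sig_K2E3GLnNilpotentFourierRegularGeThree`. OPEN residue = {(LBGL-2a) ⟸ (LBGL-2a′) road K2E5-p15 (g3), (LBGL-2b) XL, (LBGL-ge3) XL no road}.
ED. 11: (LBGL-2b) ★ p857214 ⇒ STATE: REL over {(LBGL-2a) `sig_K2E3GL2NilpotentStructure` [S2b ★ p856983∕p857002 + S2c K2E3-p12 (g4)], (LBGL-ge3) `sig_K2E3GLnNilpotentFourierRegularGeThree` [XL; K2E3-p11 (g4) MEMO §4 «RICHARDSON» kernel road]}.
ED. 13: (LBGL-2a) ★ p857002 + (LBGL-2b) ★ p857214 ⇒ the `N = 2` branch is sorry-free ⇒ STATE: REL over EXACTLY {(LBGL-ge3) `sig_K2E3GLnNilpotentFourierRegularGeThree`} (Richardson road, owner K2E3-p11 (g4): (R1b) ★ p857319, (R1c) ★ p857342, (R1d) K2E3-p20 (g5), (R2) ★ p857353, (R3) ★ p857253, (a)+(b) K2E4-p09 (g3)).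
ED. 16: (LBGL-ge3) REL over {(LBGL-3E), (LBGL-3J), (LBGL-ge4)} ⇒ (L-B_GL) STATE: REL over EXACTLY {(LBGL-3E), (LBGL-3J), (LBGL-ge4)}.
ED. 18: (LBGL-3J) ★ ⇒ (L-B_GL) STATE: REL over EXACTLY {(LBGL-3E), (LBGL-ge4)}.
ED. 20: (L-B_GL) STATE: REL over EXACTLY {(LBGL-ge4)} — sorry-free for `N ≤ 3`. -/
theorem sig_K2E3GLnNilpotentFourierRegular :
    ∀ (F : Type) [Field F] [ValuativeRel F] [TopologicalSpace F] [IsNonarchimedeanLocalField F] [CharZero F] (N : ℕ)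
      (ψ : AddChar F Circle), ψ.IsContinuousNontrivial →
      ∀ [MeasurableSpace (Matrix (Fin N) (Fin N) F)] [BorelSpace (Matrix (Fin N) (Fin N) F)] (μ𝔤 : Measure (Matrix (Fin N) (Fin N) F)) [μ𝔤.IsAddHaarMeasure],
      ∀ T : (Matrix (Fin N) (Fin N) F → ℂ) → ℂ,
        ((∀ f₁ f₂ : Matrix (Fin N) (Fin N) F → ℂ, IsLocSmooth f₁ → IsLocSmooth f₂ → T (f₁ + f₂) = T f₁ + T f₂) ∧
         (∀ (a : ℂ) (f : Matrix (Fin N) (Fin N) F → ℂ), IsLocSmooth f → T (a • f) = a * T f) ∧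
         (∀ (x : GL (Fin N) F) (f : Matrix (Fin N) (Fin N) F → ℂ), IsLocSmooth f →
            T (fun X => f ((x : Matrix (Fin N) (Fin N) F) * X * ((x⁻¹ : GL (Fin N) F) : Matrix (Fin N) (Fin N) F))) = T f) ∧
         (∀ f : Matrix (Fin N) (Fin N) F → ℂ, IsLocSmooth f → (∀ X ∈ tsupport f, ¬ IsNilpotent X) → T f = 0)) →
        ∃ Fn : Matrix (Fin N) (Fin N) F → ℂ, LocallyIntegrable Fn μ𝔤 ∧
          (∀ f : Matrix (Fin N) (Fin N) F → ℂ, IsLocSmooth f →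
              T (fun Y => ∫ X, ((ψ (Matrix.trace (Y * X)) : Circle) : ℂ) * f X ∂μ𝔤) = ∫ X, f X * Fn X ∂μ𝔤) ∧
          (∀ X : Matrix (Fin N) (Fin N) F, IsUnit X.charpoly.discr → ∀ᶠ Y in 𝓝 X, Fn Y = Fn X) ∧
          (∀ C : Set (Matrix (Fin N) (Fin N) F), IsCompact C → ∃ B : ℝ, ∀ X ∈ C,
              ((NNReal.sqrt (normAbs F X.charpoly.discr) : ℝ≥0) : ℝ) * ‖Fn X‖ ≤ B) := by
  intro F _ _ _ _ _ N
  rcases N with _ | _ | _ | N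
  · exact glnNilpotentFourierRegular_zero F
  · exact Summit.HodgeConjecture.HodgeConjecture.Cruxes.H413.K2E3GLnNilpotentFourierPointSupport.gl1_nilpotentFourierRegular F
  · intro ψ hψ _ _ μ𝔤 _ T hT
    letI : MeasurableSpace F := borel F
    haveI : BorelSpace F := ⟨rfl⟩
    letI : MeasurableSpace (GL (Fin 2) F) := borel _
    haveI : BorelSpace (GL (Fin 2) F) := ⟨rfl⟩
    haveI : CompactSpace ↥(glInt 2 F) := isCompact_iff_compactSpace.1 (isCompact_glInt 2 F)
    haveI : BorelSpace ↥(glInt 2 F) := Subtype.borelSpace _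
    exact Summit.HodgeConjecture.HodgeConjecture.Cruxes.H413.K2E3GL2NilpotentFourierRegularOfStructure.gl2_nilpotentFourierRegular_of_structure
      (ψ := ψ) (μ𝔤 := μ𝔤) (κ := (Measure.haar : Measure ↥(glInt 2 F))) (dx := (Measure.addHaar : Measure F)) hψ
      (sig_K2E3GL2NilpotentStructure F Measure.haar Measure.addHaar)
      (sig_K2E3GL2RegularNilpotentFourier F ψ hψ μ𝔤 Measure.haar Measure.addHaar) T hT
  · have h3 : 3 ≤ N + 1 + 1 + 1 := by omega
    exact fun ψ hψ => sig_K2E3GLnNilpotentFourierRegularGeThree F (N + 1 + 1 + 1) h3 ψ hψ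

set_option maxHeartbeats 1600000 in
set_option synthInstance.maxHeartbeats 400000 in
open scoped Classical in
open MeasureTheory.Measure Filter Topology Polynomial Literature.NumberTheory.GaloisRepresentations.IsNonarchimedeanLocalField Summit.HodgeConjecture.HodgeConjecture.Cruxes.H413.K2E3LieUnitary in
/-- **(L-A_U)** local character expansion at `1` of `U(σ_w,H_w)(L_w)` (non-split place) in `T̂`-form on `𝔲 = ↥(lieOfForm σ_w H_w)`, for `ψ` non-trivial on the `σ_w`-fixed field (v3, FIX-1). [cite: HarishChandra1999AdmissibleDistributions, Thm. 16.3 p. 77] 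
ED. 7 (K2E3-plan g2, 2026-09-04): HOSTED SOCKET (L-A_U)′ (repair C′ (a), ruling R-a 01:19:47Z) — statement bytes = K2E3-p12 (g3) `K2/K2E3-p12/g3/SUBSIGS-U12d-LieCore.v3.K2E3-p12-g3.lean` sha16 ac7d1d12b136db49 `subsig_K2E3ULieCharExpansionAtOne` VERBATIM (`subsig_` ↦ `sig_`); K2E3-r01 (g2) PRE-BOX PASS FIX 0 01:37:03Z. OPEN (payer files `Theorems/…lean --supports stmt-HodgeConjecture-24833 --as helper`, never importing `Lines`). -/
theorem sig_K2E3ULieCharExpansionAtOne :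
    ∀ (L : Type) [Field L] [NumberField L] [IsCMField L] (N : ℕ) (H : Matrix (Fin N) (Fin N) L),
      (H.map (cmConjRingHom L))ᵀ = H → H.det ≠ 0 →
      ∀ (v : HeightOneSpectrum (𝓞 ↥(maximalRealSubfield L))) (w : UnitaryGroup.PlacesOver L v) (hw : IsCMField.complexConj L • w.1 = w.1)
      (ψ : AddChar (w.1.adicCompletion L) Circle), ψ.IsContinuousNontrivial →
      (∃ a : w.1.adicCompletion L, galAdicCompletionMap (L := L) (IsCMField.complexConj L) hw a = a ∧ ψ a ≠ 1) →
      ∀ [MeasurableSpace ↥(lieOfForm (galAdicCompletionMap (L := L) (IsCMField.complexConj L) hw) (UnitaryGroup.placeForm H w.1))]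
        [BorelSpace ↥(lieOfForm (galAdicCompletionMap (L := L) (IsCMField.complexConj L) hw) (UnitaryGroup.placeForm H w.1))]
        (μ𝔤 : Measure ↥(lieOfForm (galAdicCompletionMap (L := L) (IsCMField.complexConj L) hw) (UnitaryGroup.placeForm H w.1))) [μ𝔤.IsAddHaarMeasure]
        [MeasurableSpace ↥(unitaryGroupOfForm (galAdicCompletionMap (L := L) (IsCMField.complexConj L) hw) (UnitaryGroup.placeForm H w.1))]
        [BorelSpace ↥(unitaryGroupOfForm (galAdicCompletionMap (L := L) (IsCMField.complexConj L) hw) (UnitaryGroup.placeForm H w.1))]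
        (μ₀ : Measure ↥(unitaryGroupOfForm (galAdicCompletionMap (L := L) (IsCMField.complexConj L) hw) (UnitaryGroup.placeForm H w.1))) [μ₀.IsHaarMeasure]
        (r₀ : SmoothIrrep ↥(unitaryGroupOfForm (galAdicCompletionMap (L := L) (IsCMField.complexConj L) hw) (UnitaryGroup.placeForm H w.1))), r₀.ρ.IsAdmissible →
        ∀ Θ₀ : ↥(unitaryGroupOfForm (galAdicCompletionMap (L := L) (IsCMField.complexConj L) hw) (UnitaryGroup.placeForm H w.1)) → ℂ,
        (∀ x₀ : ↥(unitaryGroupOfForm (galAdicCompletionMap (L := L) (IsCMField.complexConj L) hw) (UnitaryGroup.placeForm H w.1)),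
          IsRegularElt (x₀ : GL (Fin N) (w.1.adicCompletion L)) → ∀ᶠ y in 𝓝 x₀, Θ₀ y = Θ₀ x₀) →
        (∀ φ₀ : ↥(unitaryGroupOfForm (galAdicCompletionMap (L := L) (IsCMField.complexConj L) hw) (UnitaryGroup.placeForm H w.1)) → ℂ,
          IsLocSmooth φ₀ → (IrrClass.mk r₀).smoothTrace μ₀ φ₀ = ∫ x, φ₀ x * Θ₀ x ∂μ₀) →
      ∃ V : Set (Matrix (Fin N) (Fin N) (w.1.adicCompletion L)), V ∈ 𝓝 (0 : Matrix (Fin N) (Fin N) (w.1.adicCompletion L)) ∧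
      ∃ T : (↥(lieOfForm (galAdicCompletionMap (L := L) (IsCMField.complexConj L) hw) (UnitaryGroup.placeForm H w.1)) → ℂ) → ℂ,
        ((∀ f₁ f₂ : ↥(lieOfForm (galAdicCompletionMap (L := L) (IsCMField.complexConj L) hw) (UnitaryGroup.placeForm H w.1)) → ℂ, IsLocSmooth f₁ → IsLocSmooth f₂ → T (f₁ + f₂) = T f₁ + T f₂) ∧
         (∀ (a : ℂ) (f : ↥(lieOfForm (galAdicCompletionMap (L := L) (IsCMField.complexConj L) hw) (UnitaryGroup.placeForm H w.1)) → ℂ), IsLocSmooth f → T (a • f) = a * T f) ∧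
         (∀ (x : ↥(unitaryGroupOfForm (galAdicCompletionMap (L := L) (IsCMField.complexConj L) hw) (UnitaryGroup.placeForm H w.1))) (f : ↥(lieOfForm (galAdicCompletionMap (L := L) (IsCMField.complexConj L) hw) (UnitaryGroup.placeForm H w.1)) → ℂ), IsLocSmooth f →
            T (fun X => f ⟨((x : GL (Fin N) (w.1.adicCompletion L)) : Matrix (Fin N) (Fin N) (w.1.adicCompletion L)) * X.1 * (((x : GL (Fin N) (w.1.adicCompletion L))⁻¹ : GL (Fin N) (w.1.adicCompletion L)) : Matrix (Fin N) (Fin N) (w.1.adicCompletion L)),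
              conj_mem_lieOfForm x.2 X.2⟩) = T f) ∧
         (∀ f : ↥(lieOfForm (galAdicCompletionMap (L := L) (IsCMField.complexConj L) hw) (UnitaryGroup.placeForm H w.1)) → ℂ, IsLocSmooth f → (∀ X ∈ tsupport f, ¬ IsNilpotent X.1) → T f = 0)) ∧
        ∀ Fn : ↥(lieOfForm (galAdicCompletionMap (L := L) (IsCMField.complexConj L) hw) (UnitaryGroup.placeForm H w.1)) → ℂ,
          (∀ f : ↥(lieOfForm (galAdicCompletionMap (L := L) (IsCMField.complexConj L) hw) (UnitaryGroup.placeForm H w.1)) → ℂ, IsLocSmooth f → T (lieFourier (galAdicCompletionMap (L := L) (IsCMField.complexConj L) hw) (UnitaryGroup.placeForm H w.1) (fun x : w.1.adicCompletion L => ((ψ x : Circle) : ℂ)) μ𝔤 f) = ∫ X, f X * Fn X ∂μ𝔤) →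
          (∀ X : ↥(lieOfForm (galAdicCompletionMap (L := L) (IsCMField.complexConj L) hw) (UnitaryGroup.placeForm H w.1)), IsUnit X.1.charpoly.discr → ∀ᶠ Y in 𝓝 X, Fn Y = Fn X) →
          ∀ g : ↥(unitaryGroupOfForm (galAdicCompletionMap (L := L) (IsCMField.complexConj L) hw) (UnitaryGroup.placeForm H w.1)), ∀ Y : ↥(lieOfForm (galAdicCompletionMap (L := L) (IsCMField.complexConj L) hw) (UnitaryGroup.placeForm H w.1)), Y.1 ∈ V → IsUnit Y.1.charpoly.discr → IsUnit (1 - Y.1) → IsUnit (1 + Y.1) →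
            ((g : GL (Fin N) (w.1.adicCompletion L)) : Matrix (Fin N) (Fin N) (w.1.adicCompletion L)) = (1 + Y.1) * (1 - Y.1)⁻¹ → Θ₀ g = Fn Y := by
  sorry

set_option maxHeartbeats 1600000 in
set_option synthInstance.maxHeartbeats 400000 in
open scoped Classical in
open MeasureTheory.Measure Filter Topology Polynomial Literature.NumberTheory.GaloisRepresentations.IsNonarchimedeanLocalField Summit.HodgeConjecture.HodgeConjecture.Cruxes.H413.K2E3LieUnitary in
/-- **(LBU-01)** (L-B_U)′ at `N ≤ 1` — Harish-Chandra Thm. 4.4 ∕ §21 for `J(𝒩)` on `𝔲(σ_w,H_w)`, `N ≤ 1`: the nilpotent cone is `{0}`, `T = c·δ₀`, `Fn = c` (point support; payer K2E3-p14 (g4), F1 `K2E3LieUnitaryNilpotentFourierRegularOfPointSupport` + F2 `K2E3U01NilpotentFourierRegular`; size S–M). [cite: HarishChandra1999AdmissibleDistributions, Thm. 4.4 p. 11, §21 p. 87]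
ED. 14 (K2E3-plan g3, 2026-09-04 ≈05:25Z): HOSTED LEAF (LBU-01) of the (L-B_U)′ re-cut BY `N` — statement = (L-B_U)′ text with `(N : ℕ), N ≤ 1 → ∀ (H : …),` (dealer-cut cand `K2/K2E3-plan/g3/recut_LBU.cand.v1.K2E3-plan-g3.lean` 7375f752fc917b45) — and **★-TIED BY NAME** `:= @…K2E3U01NilpotentFourierRegular.uLeOne_nilpotentFourierRegular` (★ p857435∕p857440, K2E3-p14 (g4), point support; K2E3-r01 (g3) HEAD-vs-LEAF PASS + farm tie cert `Probe_RecutLBU_tieLBU01` b6b8ea0938f3fb09 05:02:29Z).  STATE: ★. -/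
theorem sig_K2E3UNilpotentFourierRegularLeOne :
    ∀ (L : Type) [Field L] [NumberField L] [IsCMField L] (N : ℕ), N ≤ 1 → ∀ (H : Matrix (Fin N) (Fin N) L),
      (H.map (cmConjRingHom L))ᵀ = H → H.det ≠ 0 →
      ∀ (v : HeightOneSpectrum (𝓞 ↥(maximalRealSubfield L))) (w : UnitaryGroup.PlacesOver L v) (hw : IsCMField.complexConj L • w.1 = w.1)
      (ψ : AddChar (w.1.adicCompletion L) Circle), ψ.IsContinuousNontrivial →
      (∃ a : w.1.adicCompletion L, galAdicCompletionMap (L := L) (IsCMField.complexConj L) hw a = a ∧ ψ a ≠ 1) →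
      ∀ [MeasurableSpace ↥(lieOfForm (galAdicCompletionMap (L := L) (IsCMField.complexConj L) hw) (UnitaryGroup.placeForm H w.1))]
        [BorelSpace ↥(lieOfForm (galAdicCompletionMap (L := L) (IsCMField.complexConj L) hw) (UnitaryGroup.placeForm H w.1))]
        (μ𝔤 : Measure ↥(lieOfForm (galAdicCompletionMap (L := L) (IsCMField.complexConj L) hw) (UnitaryGroup.placeForm H w.1))) [μ𝔤.IsAddHaarMeasure],
      ∀ T : (↥(lieOfForm (galAdicCompletionMap (L := L) (IsCMField.complexConj L) hw) (UnitaryGroup.placeForm H w.1)) → ℂ) → ℂ,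
        ((∀ f₁ f₂ : ↥(lieOfForm (galAdicCompletionMap (L := L) (IsCMField.complexConj L) hw) (UnitaryGroup.placeForm H w.1)) → ℂ, IsLocSmooth f₁ → IsLocSmooth f₂ → T (f₁ + f₂) = T f₁ + T f₂) ∧
         (∀ (a : ℂ) (f : ↥(lieOfForm (galAdicCompletionMap (L := L) (IsCMField.complexConj L) hw) (UnitaryGroup.placeForm H w.1)) → ℂ), IsLocSmooth f → T (a • f) = a * T f) ∧
         (∀ (x : ↥(unitaryGroupOfForm (galAdicCompletionMap (L := L) (IsCMField.complexConj L) hw) (UnitaryGroup.placeForm H w.1))) (f : ↥(lieOfForm (galAdicCompletionMap (L := L) (IsCMField.complexConj L) hw) (UnitaryGroup.placeForm H w.1)) → ℂ), IsLocSmooth f →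
            T (fun X => f ⟨((x : GL (Fin N) (w.1.adicCompletion L)) : Matrix (Fin N) (Fin N) (w.1.adicCompletion L)) * X.1 * (((x : GL (Fin N) (w.1.adicCompletion L))⁻¹ : GL (Fin N) (w.1.adicCompletion L)) : Matrix (Fin N) (Fin N) (w.1.adicCompletion L)),
              conj_mem_lieOfForm x.2 X.2⟩) = T f) ∧
         (∀ f : ↥(lieOfForm (galAdicCompletionMap (L := L) (IsCMField.complexConj L) hw) (UnitaryGroup.placeForm H w.1)) → ℂ, IsLocSmooth f → (∀ X ∈ tsupport f, ¬ IsNilpotent X.1) → T f = 0)) →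
        ∃ Fn : ↥(lieOfForm (galAdicCompletionMap (L := L) (IsCMField.complexConj L) hw) (UnitaryGroup.placeForm H w.1)) → ℂ, LocallyIntegrable Fn μ𝔤 ∧
          (∀ f : ↥(lieOfForm (galAdicCompletionMap (L := L) (IsCMField.complexConj L) hw) (UnitaryGroup.placeForm H w.1)) → ℂ, IsLocSmooth f → T (lieFourier (galAdicCompletionMap (L := L) (IsCMField.complexConj L) hw) (UnitaryGroup.placeForm H w.1) (fun x : w.1.adicCompletion L => ((ψ x : Circle) : ℂ)) μ𝔤 f) = ∫ X, f X * Fn X ∂μ𝔤) ∧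
          (∀ X : ↥(lieOfForm (galAdicCompletionMap (L := L) (IsCMField.complexConj L) hw) (UnitaryGroup.placeForm H w.1)), IsUnit X.1.charpoly.discr → ∀ᶠ Y in 𝓝 X, Fn Y = Fn X) ∧
          (∀ C : Set ↥(lieOfForm (galAdicCompletionMap (L := L) (IsCMField.complexConj L) hw) (UnitaryGroup.placeForm H w.1)), IsCompact C → ∃ B : ℝ, ∀ X ∈ C,
              ((NNReal.sqrt (NNReal.sqrt (normAbs (w.1.adicCompletion L) X.1.charpoly.discr)) : ℝ≥0) : ℝ) * ‖Fn X‖ ≤ B) :=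
  @Summit.HodgeConjecture.HodgeConjecture.Cruxes.H413.K2E3U01NilpotentFourierRegular.uLeOne_nilpotentFourierRegular

set_option maxHeartbeats 1600000 in
set_option synthInstance.maxHeartbeats 400000 in
open scoped Classical in
open MeasureTheory.Measure Filter Topology Polynomial Literature.NumberTheory.GaloisRepresentations.IsNonarchimedeanLocalField Summit.HodgeConjecture.HodgeConjecture.Cruxes.H413.K2E3LieUnitary in
/-- **(LBGL-2b-Tw) the `χ̃`-twisted (LBGL-2b)** — Harish-Chandra's regularity theorem for the `χ̃(t·det k)`-twisted regular nilpotent orbital integral of `𝔤𝔩₂(F)`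
(`χ` quadratic non-trivial: the Labesse–Langlands unstable combination of the two `det⁻¹(ker χ)`-classes of regular nilpotents), size L (K2E5-p10 (g4) K-side (K1)–(K5) over
K2E5-p17 (g3)'s ★ line side). [cite: HarishChandra1999AdmissibleDistributions, Thm. 4.4 p. 11, Lemma 5.2, Lemma 7.8] [cite: LabesseLanglands1979, §5]
ED. 14 (K2E3-plan g3): HOSTED SUB-LEAF (LBGL-2b-Tw) of (LBU-2⁺) — statement bytes = K2E3-p12 (g5) `K2/K2E3-p12/g5/SUBSIG-LBGL2bTw.K2E3-p12-g5.lean` sha16 5de2c4e2bd026757 `subsig_K2E3GL2TwistedRegularNilpotentFourier` VERBATIM (`subsig_` ↦ `sig_`); K2E3-r01 (g3) R15 PRE-BOX PASS 05:18:37Z.  Payer: K2E5-p10 (g4) (K5) over K2E5-p17 (g3) line side.  STATE: OPEN.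
ED. 17 (K2E3-plan g3, 2026-09-04 ≈06:10Z): **★-TIED BY NAME** `:= @…K2E3GL2TwistedRegularNilpotentFourier.gl2TwistedRegularNilpotentFourier` — ★ p857728 (K2E3-p12 (g5), (K5) road: (K5d) ★ p857687 over (K4-b⁺) ★ p857688 K2E5-p10 (g5) + (K4-c) ★ p857659 K2E3-p14 (g4)); by-import kernel cert `K2/K2E3-p12/g5/probes/ProbeTie_LBGL2bTw.K2E3-p12-g5.lean` b0834662c335114e (`type_of%` both ways, rc 0 s0, 05:58:01Z).  STATE: ★-tied. -/
theorem sig_K2E3GL2TwistedRegularNilpotentFourier :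
    ∀ (F : Type) [Field F] [ValuativeRel F] [TopologicalSpace F] [IsNonarchimedeanLocalField F] [CharZero F]
      (ψ : AddChar F Circle), ψ.IsContinuousNontrivial → ∀ (χ : QuasiChar F), (∀ u : Fˣ, χ u * χ u = 1) → (∃ u : Fˣ, χ u ≠ 1) →
      ∀ [MeasurableSpace (Matrix (Fin 2) (Fin 2) F)] [BorelSpace (Matrix (Fin 2) (Fin 2) F)] (μ𝔤 : Measure (Matrix (Fin 2) (Fin 2) F)) [μ𝔤.IsAddHaarMeasure]
        [MeasurableSpace F] [BorelSpace F] [MeasurableSpace (GL (Fin 2) F)] [BorelSpace (GL (Fin 2) F)]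
        (κ : Measure ↥(glInt 2 F)) [IsHaarMeasure κ] (dx : Measure F) [dx.IsAddHaarMeasure],
      ∃ Fr : Matrix (Fin 2) (Fin 2) F → ℂ, LocallyIntegrable Fr μ𝔤 ∧
        (∀ f : Matrix (Fin 2) (Fin 2) F → ℂ, IsLocSmooth f →
          ∫ p : ↥(glInt 2 F) × F, Function.extend ((↑) : Fˣ → F) (fun u => ((χ u : ℂˣ) : ℂ)) 0 (p.2 * (((p.1 : GL (Fin 2) F) : Matrix (Fin 2) (Fin 2) F)).det) *
            (fun Y : Matrix (Fin 2) (Fin 2) F => ∫ X, ((ψ (Matrix.trace (Y * X)) : Circle) : ℂ) * f X ∂μ𝔤)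
              (((p.1 : GL (Fin 2) F) : Matrix (Fin 2) (Fin 2) F) * !![0, p.2; 0, 0] * ((((p.1 : GL (Fin 2) F))⁻¹ : GL (Fin 2) F) : Matrix (Fin 2) (Fin 2) F)) ∂(κ.prod dx) =
            ∫ X, f X * Fr X ∂μ𝔤) ∧
        (∀ X : Matrix (Fin 2) (Fin 2) F, IsUnit X.charpoly.discr → ∀ᶠ Y in 𝓝 X, Fr Y = Fr X) ∧
        (∀ C : Set (Matrix (Fin 2) (Fin 2) F), IsCompact C → ∃ B : ℝ, ∀ X ∈ C,
            ((NNReal.sqrt (normAbs F X.charpoly.discr) : ℝ≥0) : ℝ) * ‖Fr X‖ ≤ B) :=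
  @Summit.HodgeConjecture.HodgeConjecture.Cruxes.H413.K2E3GL2TwistedRegularNilpotentFourier.gl2TwistedRegularNilpotentFourier

set_option maxHeartbeats 1600000 in
set_option synthInstance.maxHeartbeats 400000 in
open scoped Classical in
open MeasureTheory.Measure Filter Topology Polynomial Literature.NumberTheory.GaloisRepresentations.IsNonarchimedeanLocalField Summit.HodgeConjecture.HodgeConjecture.Cruxes.H413.K2E3LieUnitary in
/-- **(LBU-2⁺) `(L-B_GL)^{Nm}` ON `𝔤𝔩₂(L⁺_v)`** — residual sub-leaf of (L-B_U)′ :373 at `N = 2` (size L–XL; structure ★ p857116 `nilpotentStructure_of_detSubgroup` reduces it to the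
Fourier regularity of the two `G⁺`-nilpotent orbital integrals `ν̂_{𝒪±}` separately, equivalently of `ν̂_reg` ((LBGL-2b)) AND of the `ω_{L_w∕L⁺_v}`-twisted `ν̂_ω = ν̂₊ − ν̂₋`).
[cite: HarishChandra1999AdmissibleDistributions, Thm. 4.4 p. 11, Lemma 5.2, Thm. 5.11 p. 47]
ED. 14 (K2E3-plan g3): HOSTED LEAF (LBU-2⁺) — statement bytes = K2E3-p12 (g4) `K2/K2E3-p12/g4/SUBSIG-LBU2-GL2Nm.K2E3-p12-g4.lean` sha16 6c7dcf99dbb3c357 `subsig_K2E3GL2NmNilpotentFourierRegular` VERBATIM (`subsig_` ↦ `sig_`; K2E3-r01 (g3) PRE-BOX PASS 04:28:19Z); consumed at `N = 2` by ★ p857300 in the (L-B_U)′ dispatch; **TIED over the sub-leaf (LBGL-2b-Tw)** — body = K2E3-p12 (g5) `tie_LBU2plus_of_subsig` VERBATIM through ★ p857555 `gl2Nm_nilpotentFourierRegular_of_twisted_local` (⟸ ★ p857526 hB dock ⟸ ★ p857380 ⟸ ★ p857331).  STATE: REL over EXACTLY {(LBGL-2b-Tw)}.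
ED. 17: (LBGL-2b-Tw) ★ ⇒ (LBU-2⁺) STATE: ★-tied (sorry-free closure: `tie_LBU2plus_of_subsig` over ★ p857555 over ★ p857728). -/
theorem sig_K2E3GL2NmNilpotentFourierRegular :
    ∀ (L : Type) [Field L] [NumberField L] [IsCMField L] (v : HeightOneSpectrum (𝓞 ↥(maximalRealSubfield L))) (w : UnitaryGroup.PlacesOver L v)
      (hw : IsCMField.complexConj L • w.1 = w.1) (ψ : AddChar (w.1.adicCompletion L) Circle), ψ.IsContinuousNontrivial →
      (∃ a : w.1.adicCompletion L, galAdicCompletionMap (L := L) (IsCMField.complexConj L) hw a = a ∧ ψ a ≠ 1) →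
      ∀ [MeasurableSpace (Matrix (Fin 2) (Fin 2) (v.adicCompletion ↥(maximalRealSubfield L)))] [BorelSpace (Matrix (Fin 2) (Fin 2) (v.adicCompletion ↥(maximalRealSubfield L)))] (μ' : Measure (Matrix (Fin 2) (Fin 2) (v.adicCompletion ↥(maximalRealSubfield L)))) [μ'.IsAddHaarMeasure]
      (T' : ((Matrix (Fin 2) (Fin 2) (v.adicCompletion ↥(maximalRealSubfield L))) → ℂ) → ℂ),
      (∀ f₁ f₂ : (Matrix (Fin 2) (Fin 2) (v.adicCompletion ↥(maximalRealSubfield L))) → ℂ, IsLocSmooth f₁ → IsLocSmooth f₂ → T' (f₁ + f₂) = T' f₁ + T' f₂) →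
      (∀ (a : ℂ) (f : (Matrix (Fin 2) (Fin 2) (v.adicCompletion ↥(maximalRealSubfield L))) → ℂ), IsLocSmooth f → T' (a • f) = a * T' f) →
      (∀ g : GL (Fin 2) (v.adicCompletion ↥(maximalRealSubfield L)), (∃ e : w.1.adicCompletion L, toPlace v w ((g : Matrix (Fin 2) (Fin 2) (v.adicCompletion ↥(maximalRealSubfield L))).det) * (e * galAdicCompletionMap (L := L) (IsCMField.complexConj L) hw e) = 1) →
        ∀ f : (Matrix (Fin 2) (Fin 2) (v.adicCompletion ↥(maximalRealSubfield L))) → ℂ, IsLocSmooth f → T' (fun X => f ((g : Matrix (Fin 2) (Fin 2) (v.adicCompletion ↥(maximalRealSubfield L))) * X * ((g⁻¹ : GL (Fin 2) (v.adicCompletion ↥(maximalRealSubfield L))) : Matrix (Fin 2) (Fin 2) (v.adicCompletion ↥(maximalRealSubfield L))))) = T' f) →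
      (∀ f : (Matrix (Fin 2) (Fin 2) (v.adicCompletion ↥(maximalRealSubfield L))) → ℂ, IsLocSmooth f → (∀ X ∈ tsupport f, ¬ IsNilpotent X) → T' f = 0) →
      ∃ Fn' : (Matrix (Fin 2) (Fin 2) (v.adicCompletion ↥(maximalRealSubfield L))) → ℂ, LocallyIntegrable Fn' μ' ∧
        (∀ f : (Matrix (Fin 2) (Fin 2) (v.adicCompletion ↥(maximalRealSubfield L))) → ℂ, IsLocSmooth f →
          T' (fun Y => ∫ X, ((ψ (toPlace v w (Matrix.trace (Y * X))) : Circle) : ℂ) * f X ∂μ') = ∫ X, f X * Fn' X ∂μ') ∧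
        (∀ X : Matrix (Fin 2) (Fin 2) (v.adicCompletion ↥(maximalRealSubfield L)), IsUnit X.charpoly.discr → ∀ᶠ Y in 𝓝 X, Fn' Y = Fn' X) ∧
        (∀ C : Set (Matrix (Fin 2) (Fin 2) (v.adicCompletion ↥(maximalRealSubfield L))), IsCompact C → ∃ B : ℝ, ∀ X ∈ C, ((NNReal.sqrt (normAbs (v.adicCompletion ↥(maximalRealSubfield L)) X.charpoly.discr) : ℝ≥0) : ℝ) * ‖Fn' X‖ ≤ B) :=
  fun L _ _ _ v w hw ψ hψ hψι =>
    K2E3GL2NmNilpotentFourierRegularOfTwistedLocal.gl2Nm_nilpotentFourierRegular_of_twisted_local L v w hw ψ hψ hψι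
      sig_K2E3GL2TwistedRegularNilpotentFourier

set_option maxHeartbeats 1600000 in
set_option synthInstance.maxHeartbeats 400000 in
open scoped Classical in
open MeasureTheory.Measure Filter Topology Polynomial Literature.NumberTheory.GaloisRepresentations.IsNonarchimedeanLocalField Summit.HodgeConjecture.HodgeConjecture.Cruxes.H413.K2E3LieUnitary in
/-- **(LBU-ge3)** (L-B_U)′ at `3 ≤ N` — Harish-Chandra Thm. 4.4 ∕ §21 for `J(𝒩)` on `𝔲(σ_w,H_w)`, `N ≥ 3` (OPEN, XL; no road in tree — §L lead K2E3-p12 (g4) 04:45:24Z). [cite: HarishChandra1999AdmissibleDistributions, Thm. 4.4 p. 11, §21 p. 87]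
ED. 14 (K2E3-plan g3): HOSTED LEAF (LBU-ge3) of the (L-B_U)′ re-cut BY `N` — statement = (L-B_U)′ text with `(N : ℕ), 3 ≤ N → ∀ (H : …),`; OPEN, XL, no road in tree (§L lead K2E3-p12 (g4) seat-close word 04:45:24Z).  STATE: OPEN. -/
theorem sig_K2E3UNilpotentFourierRegularGeThree :
    ∀ (L : Type) [Field L] [NumberField L] [IsCMField L] (N : ℕ), 3 ≤ N → ∀ (H : Matrix (Fin N) (Fin N) L),
      (H.map (cmConjRingHom L))ᵀ = H → H.det ≠ 0 →
      ∀ (v : HeightOneSpectrum (𝓞 ↥(maximalRealSubfield L))) (w : UnitaryGroup.PlacesOver L v) (hw : IsCMField.complexConj L • w.1 = w.1)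
      (ψ : AddChar (w.1.adicCompletion L) Circle), ψ.IsContinuousNontrivial →
      (∃ a : w.1.adicCompletion L, galAdicCompletionMap (L := L) (IsCMField.complexConj L) hw a = a ∧ ψ a ≠ 1) →
      ∀ [MeasurableSpace ↥(lieOfForm (galAdicCompletionMap (L := L) (IsCMField.complexConj L) hw) (UnitaryGroup.placeForm H w.1))]
        [BorelSpace ↥(lieOfForm (galAdicCompletionMap (L := L) (IsCMField.complexConj L) hw) (UnitaryGroup.placeForm H w.1))]
        (μ𝔤 : Measure ↥(lieOfForm (galAdicCompletionMap (L := L) (IsCMField.complexConj L) hw) (UnitaryGroup.placeForm H w.1))) [μ𝔤.IsAddHaarMeasure],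
      ∀ T : (↥(lieOfForm (galAdicCompletionMap (L := L) (IsCMField.complexConj L) hw) (UnitaryGroup.placeForm H w.1)) → ℂ) → ℂ,
        ((∀ f₁ f₂ : ↥(lieOfForm (galAdicCompletionMap (L := L) (IsCMField.complexConj L) hw) (UnitaryGroup.placeForm H w.1)) → ℂ, IsLocSmooth f₁ → IsLocSmooth f₂ → T (f₁ + f₂) = T f₁ + T f₂) ∧
         (∀ (a : ℂ) (f : ↥(lieOfForm (galAdicCompletionMap (L := L) (IsCMField.complexConj L) hw) (UnitaryGroup.placeForm H w.1)) → ℂ), IsLocSmooth f → T (a • f) = a * T f) ∧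
         (∀ (x : ↥(unitaryGroupOfForm (galAdicCompletionMap (L := L) (IsCMField.complexConj L) hw) (UnitaryGroup.placeForm H w.1))) (f : ↥(lieOfForm (galAdicCompletionMap (L := L) (IsCMField.complexConj L) hw) (UnitaryGroup.placeForm H w.1)) → ℂ), IsLocSmooth f →
            T (fun X => f ⟨((x : GL (Fin N) (w.1.adicCompletion L)) : Matrix (Fin N) (Fin N) (w.1.adicCompletion L)) * X.1 * (((x : GL (Fin N) (w.1.adicCompletion L))⁻¹ : GL (Fin N) (w.1.adicCompletion L)) : Matrix (Fin N) (Fin N) (w.1.adicCompletion L)),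
              conj_mem_lieOfForm x.2 X.2⟩) = T f) ∧
         (∀ f : ↥(lieOfForm (galAdicCompletionMap (L := L) (IsCMField.complexConj L) hw) (UnitaryGroup.placeForm H w.1)) → ℂ, IsLocSmooth f → (∀ X ∈ tsupport f, ¬ IsNilpotent X.1) → T f = 0)) →
        ∃ Fn : ↥(lieOfForm (galAdicCompletionMap (L := L) (IsCMField.complexConj L) hw) (UnitaryGroup.placeForm H w.1)) → ℂ, LocallyIntegrable Fn μ𝔤 ∧
          (∀ f : ↥(lieOfForm (galAdicCompletionMap (L := L) (IsCMField.complexConj L) hw) (UnitaryGroup.placeForm H w.1)) → ℂ, IsLocSmooth f → T (lieFourier (galAdicCompletionMap (L := L) (IsCMField.complexConj L) hw) (UnitaryGroup.placeForm H w.1) (fun x : w.1.adicCompletion L => ((ψ x : Circle) : ℂ)) μ𝔤 f) = ∫ X, f X * Fn X ∂μ𝔤) ∧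
          (∀ X : ↥(lieOfForm (galAdicCompletionMap (L := L) (IsCMField.complexConj L) hw) (UnitaryGroup.placeForm H w.1)), IsUnit X.1.charpoly.discr → ∀ᶠ Y in 𝓝 X, Fn Y = Fn X) ∧
          (∀ C : Set ↥(lieOfForm (galAdicCompletionMap (L := L) (IsCMField.complexConj L) hw) (UnitaryGroup.placeForm H w.1)), IsCompact C → ∃ B : ℝ, ∀ X ∈ C,
              ((NNReal.sqrt (NNReal.sqrt (normAbs (w.1.adicCompletion L) X.1.charpoly.discr)) : ℝ≥0) : ℝ) * ‖Fn X‖ ≤ B) := by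
  sorry

set_option maxHeartbeats 1600000 in
set_option synthInstance.maxHeartbeats 400000 in
open scoped Classical in
open MeasureTheory.Measure Filter Topology Polynomial Literature.NumberTheory.GaloisRepresentations.IsNonarchimedeanLocalField Summit.HodgeConjecture.HodgeConjecture.Cruxes.H413.K2E3LieUnitary in
/-- **(L-B_U)** Harish-Chandra's Thm. 4.4 ∕ §21 for `J(𝒩)` on `𝔲(σ_w,H_w)`, for `ψ` non-trivial on the `σ_w`-fixed field (v3, FIX-1). [cite: HarishChandra1999AdmissibleDistributions, Thm. 4.4 p. 11, §21 p. 87] 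
ED. 7 (K2E3-plan g2, 2026-09-04): HOSTED SOCKET (L-B_U)′ (repair C′ (a), ruling R-a 01:19:47Z) — statement bytes = K2E3-p12 (g3) `K2/K2E3-p12/g3/SUBSIGS-U12d-LieCore.v3.K2E3-p12-g3.lean` sha16 ac7d1d12b136db49 `subsig_K2E3UNilpotentFourierRegular` VERBATIM (`subsig_` ↦ `sig_`); K2E3-r01 (g2) PRE-BOX PASS FIX 0 01:37:03Z. OPEN (payer files `Theorems/…lean --supports stmt-HodgeConjecture-24833 --as helper`, never importing `Lines`).
ED. 14 (K2E3-plan g3, 2026-09-04 ≈05:25Z; re-cut pen): **RE-TIED RELATIVELY BY `N`** (socket bytes frozen; stays an OPEN socket for the count until its leaves close): `N ≤ 1` ↦ (LBU-01) `sig_K2E3UNilpotentFourierRegularLeOne` ★; `N = 2` ↦ ★ p857300 `K2E3U2NilpotentFourierRegularOfGL2.u2_nilpotentFourierRegular_of_gl2Nm` ∘ (LBU-2⁺) `sig_K2E3GL2NmNilpotentFourierRegular` (REL over (LBGL-2b-Tw)); `3 ≤ N` ↦ (LBU-ge3) `sig_K2E3UNilpotentFourierRegularGeThree`.  Dealer-cut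 cand `K2/K2E3-plan/g3/recut_LBU.cand.v1.K2E3-plan-g3.lean` 7375f752fc917b45 (farm rc 0, dispatch sorry-free; r01 05:02:29Z).  STATE: REL over EXACTLY {(LBGL-2b-Tw), (LBU-ge3)}.
ED. 17: (LBGL-2b-Tw) ★ ⇒ (L-B_U)′ STATE: REL over EXACTLY {(LBU-ge3) `sig_K2E3UNilpotentFourierRegularGeThree`} (N ≤ 2 sorry-free). -/
theorem sig_K2E3UNilpotentFourierRegular :
    ∀ (L : Type) [Field L] [NumberField L] [IsCMField L] (N : ℕ) (H : Matrix (Fin N) (Fin N) L),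
      (H.map (cmConjRingHom L))ᵀ = H → H.det ≠ 0 →
      ∀ (v : HeightOneSpectrum (𝓞 ↥(maximalRealSubfield L))) (w : UnitaryGroup.PlacesOver L v) (hw : IsCMField.complexConj L • w.1 = w.1)
      (ψ : AddChar (w.1.adicCompletion L) Circle), ψ.IsContinuousNontrivial →
      (∃ a : w.1.adicCompletion L, galAdicCompletionMap (L := L) (IsCMField.complexConj L) hw a = a ∧ ψ a ≠ 1) →
      ∀ [MeasurableSpace ↥(lieOfForm (galAdicCompletionMap (L := L) (IsCMField.complexConj L) hw) (UnitaryGroup.placeForm H w.1))]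
        [BorelSpace ↥(lieOfForm (galAdicCompletionMap (L := L) (IsCMField.complexConj L) hw) (UnitaryGroup.placeForm H w.1))]
        (μ𝔤 : Measure ↥(lieOfForm (galAdicCompletionMap (L := L) (IsCMField.complexConj L) hw) (UnitaryGroup.placeForm H w.1))) [μ𝔤.IsAddHaarMeasure],
      ∀ T : (↥(lieOfForm (galAdicCompletionMap (L := L) (IsCMField.complexConj L) hw) (UnitaryGroup.placeForm H w.1)) → ℂ) → ℂ,
        ((∀ f₁ f₂ : ↥(lieOfForm (galAdicCompletionMap (L := L) (IsCMField.complexConj L) hw) (UnitaryGroup.placeForm H w.1)) → ℂ, IsLocSmooth f₁ → IsLocSmooth f₂ → T (f₁ + f₂) = T f₁ + T f₂) ∧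
         (∀ (a : ℂ) (f : ↥(lieOfForm (galAdicCompletionMap (L := L) (IsCMField.complexConj L) hw) (UnitaryGroup.placeForm H w.1)) → ℂ), IsLocSmooth f → T (a • f) = a * T f) ∧
         (∀ (x : ↥(unitaryGroupOfForm (galAdicCompletionMap (L := L) (IsCMField.complexConj L) hw) (UnitaryGroup.placeForm H w.1))) (f : ↥(lieOfForm (galAdicCompletionMap (L := L) (IsCMField.complexConj L) hw) (UnitaryGroup.placeForm H w.1)) → ℂ), IsLocSmooth f →
            T (fun X => f ⟨((x : GL (Fin N) (w.1.adicCompletion L)) : Matrix (Fin N) (Fin N) (w.1.adicCompletion L)) * X.1 * (((x : GL (Fin N) (w.1.adicCompletion L))⁻¹ : GL (Fin N) (w.1.adicCompletion L)) : Matrix (Fin N) (Fin N) (w.1.adicCompletion L)),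
              conj_mem_lieOfForm x.2 X.2⟩) = T f) ∧
         (∀ f : ↥(lieOfForm (galAdicCompletionMap (L := L) (IsCMField.complexConj L) hw) (UnitaryGroup.placeForm H w.1)) → ℂ, IsLocSmooth f → (∀ X ∈ tsupport f, ¬ IsNilpotent X.1) → T f = 0)) →
        ∃ Fn : ↥(lieOfForm (galAdicCompletionMap (L := L) (IsCMField.complexConj L) hw) (UnitaryGroup.placeForm H w.1)) → ℂ, LocallyIntegrable Fn μ𝔤 ∧
          (∀ f : ↥(lieOfForm (galAdicCompletionMap (L := L) (IsCMField.complexConj L) hw) (UnitaryGroup.placeForm H w.1)) → ℂ, IsLocSmooth f → T (lieFourier (galAdicCompletionMap (L := L) (IsCMField.complexConj L) hw) (UnitaryGroup.placeForm H w.1) (fun x : w.1.adicCompletion L => ((ψ x : Circle) : ℂ)) μ𝔤 f) = ∫ X, f X * Fn X ∂μ𝔤) ∧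
          (∀ X : ↥(lieOfForm (galAdicCompletionMap (L := L) (IsCMField.complexConj L) hw) (UnitaryGroup.placeForm H w.1)), IsUnit X.1.charpoly.discr → ∀ᶠ Y in 𝓝 X, Fn Y = Fn X) ∧
          (∀ C : Set ↥(lieOfForm (galAdicCompletionMap (L := L) (IsCMField.complexConj L) hw) (UnitaryGroup.placeForm H w.1)), IsCompact C → ∃ B : ℝ, ∀ X ∈ C,
              ((NNReal.sqrt (NNReal.sqrt (normAbs (w.1.adicCompletion L) X.1.charpoly.discr)) : ℝ≥0) : ℝ) * ‖Fn X‖ ≤ B) := by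
  intro L _ _ _ N
  rcases Nat.lt_or_ge N 2 with hN | hN
  · exact sig_K2E3UNilpotentFourierRegularLeOne L N (by omega)
  · rcases Nat.eq_or_lt_of_le hN with rfl | hN3
    · intro H hH hdet v w hw ψ hψ hψι _ _ μ𝔤 _ T hT
      exact Summit.HodgeConjecture.HodgeConjecture.Cruxes.H413.K2E3U2NilpotentFourierRegularOfGL2.u2_nilpotentFourierRegular_of_gl2Nm L v w hw H hH hdet ψ hψ hψι
        (sig_K2E3GL2NmNilpotentFourierRegular L v w hw ψ hψ hψι) μ𝔤 T hT
    · exact sig_K2E3UNilpotentFourierRegularGeThree L N (by omega)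

set_option maxHeartbeats 1600000 in
set_option synthInstance.maxHeartbeats 400000 in
open scoped Classical in
open MeasureTheory.Measure Filter Topology Polynomial Literature.NumberTheory.GaloisRepresentations.IsNonarchimedeanLocalField Summit.HodgeConjecture.HodgeConjecture.Cruxes.H413.K2E3LieUnitary in
/-- **(12D-le2)** (12-D) for `N ≤ 2` — PAID ★ BY NAME (vacuous: semisimple ⇒ regular or central for `N ≤ 2`). [cite: HarishChandra1999AdmissibleDistributions, Thm. 16.3 p. 77, §18 pp. 78–79]
ED. 16 (K2E3-plan g3): HOSTED LEAF (12D-le2) — statement + ★ body bytes = §L lead K2E3-p12 (g5) cand `K2/K2E3-p12/g5/recut_12D.cand.v1.K2E3-p12-g5.lean` sha16 67a64716ade6d1c9 VERBATIM (r01 HEAD-vs-SOCKET + PRE-BOX PASS 05:25:24Z: the honest vacuous range — `¬IsRegularElt s ∧ s ∉ Z` unsatisfiable for `N ≤ 2`).  STATE: ★-tied (`K2E3NormalizedCharBddNearSingularDescentLeTwo`). -/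
theorem sig_K2E3NormalizedCharBddNearSingularDescentLeTwo :
    ∀ (L : Type) [Field L] [NumberField L] [IsCMField L] (N : ℕ), N ≤ 2 → ∀ (H : Matrix (Fin N) (Fin N) L),
      (H.map (cmConjRingHom L))ᵀ = H → H.det ≠ 0 →
      ∀ (v : HeightOneSpectrum (𝓞 ↥(maximalRealSubfield L)))
        [MeasurableSpace ((UnitaryGroup.cmDatum L N H).Local v)] [BorelSpace ((UnitaryGroup.cmDatum L N H).Local v)]
        (μ : Measure ((UnitaryGroup.cmDatum L N H).Local v)) [μ.IsHaarMeasure]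
        (c : IrrClass ((UnitaryGroup.cmDatum L N H).Local v)) (Θ : (UnitaryGroup.cmDatum L N H).Local v → ℂ),
        LocallyIntegrable Θ μ →
        (∀ x : (UnitaryGroup.cmDatum L N H).Local v,
          IsRegularElt (x.val : GL (Fin N) (UnitaryGroup.LocalRing L v)) → ∀ᶠ y in 𝓝 x, Θ y = Θ x) →
        (∀ φ : (UnitaryGroup.cmDatum L N H).Local v → ℂ, IsLocSmooth φ → c.smoothTrace μ φ = ∫ x, φ x * Θ x ∂μ) →
      ∀ s : (UnitaryGroup.cmDatum L N H).Local v, Module.End.IsSemisimple (Matrix.toLin' ((s.val : GL (Fin N) (UnitaryGroup.LocalRing L v)).val : Matrix (Fin N) (Fin N) (UnitaryGroup.LocalRing L v))) →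
        ¬ IsRegularElt (s.val : GL (Fin N) (UnitaryGroup.LocalRing L v)) → s ∉ Subgroup.center ((UnitaryGroup.cmDatum L N H).Local v) →
        ∃ U : Set ((UnitaryGroup.cmDatum L N H).Local v), IsOpen U ∧ s ∈ U ∧
        ∃ B : ℝ, ∀ g ∈ U, ∀ u : (UnitaryGroup.LocalRing L v)ˣ,
          (u : UnitaryGroup.LocalRing L v) *
              (((g.val : GL (Fin N) (UnitaryGroup.LocalRing L v)).val : Matrix (Fin N) (Fin N) (UnitaryGroup.LocalRing L v)).det) ^ (N - 1) =
            (((g.val : GL (Fin N) (UnitaryGroup.LocalRing L v)).val : Matrix (Fin N) (Fin N) (UnitaryGroup.LocalRing L v)).charpoly).discr →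
          ((NNReal.sqrt (NNReal.sqrt (unitModulusChar (UnitaryGroup.LocalRing L v) u)) : ℝ≥0) : ℝ) * ‖Θ g‖ ≤ B :=
  @Summit.HodgeConjecture.HodgeConjecture.Cruxes.H413.K2E3NormalizedCharBddNearSingularDescentLeTwo.normalizedCharBddNearSingularDescent_of_le_two

set_option maxHeartbeats 1600000 in
set_option synthInstance.maxHeartbeats 400000 in
open scoped Classical in
open MeasureTheory.Measure Filter Topology Polynomial Literature.NumberTheory.GaloisRepresentations.IsNonarchimedeanLocalField Summit.HodgeConjecture.HodgeConjecture.Cruxes.H413.K2E3LieUnitary in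
/-- **(12D-ge3)** (12-D) for `N ≥ 3` — OPEN (XL): Harish-Chandra's descent near a non-central singular semisimple `s` to `G_s` (`N = 3`: `G_s = U(2) × U(1)`).
[cite: HarishChandra1999AdmissibleDistributions, Thm. 16.3 p. 77, §18 pp. 78–79] [cite: Rogawski1990, §3.8 p. 34]
ED. 16 (K2E3-plan g3): HOSTED LEAF (12D-ge3) — statement = (12-D) text with `(N : ℕ), 3 ≤ N → ∀ (H : …),` (same cand, pre-boxed); the CONTENT of (12-D) (first live case `s ∼ diag(α,α,β)`, `G_s = U(2)×U(1)`, Harish-Chandra descent §18).  STATE: OPEN. -/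
theorem sig_K2E3NormalizedCharBddNearSingularDescentGeThree :
    ∀ (L : Type) [Field L] [NumberField L] [IsCMField L] (N : ℕ), 3 ≤ N → ∀ (H : Matrix (Fin N) (Fin N) L),
      (H.map (cmConjRingHom L))ᵀ = H → H.det ≠ 0 →
      ∀ (v : HeightOneSpectrum (𝓞 ↥(maximalRealSubfield L)))
        [MeasurableSpace ((UnitaryGroup.cmDatum L N H).Local v)] [BorelSpace ((UnitaryGroup.cmDatum L N H).Local v)]
        (μ : Measure ((UnitaryGroup.cmDatum L N H).Local v)) [μ.IsHaarMeasure]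
        (c : IrrClass ((UnitaryGroup.cmDatum L N H).Local v)) (Θ : (UnitaryGroup.cmDatum L N H).Local v → ℂ),
        LocallyIntegrable Θ μ →
        (∀ x : (UnitaryGroup.cmDatum L N H).Local v,
          IsRegularElt (x.val : GL (Fin N) (UnitaryGroup.LocalRing L v)) → ∀ᶠ y in 𝓝 x, Θ y = Θ x) →
        (∀ φ : (UnitaryGroup.cmDatum L N H).Local v → ℂ, IsLocSmooth φ → c.smoothTrace μ φ = ∫ x, φ x * Θ x ∂μ) →
      ∀ s : (UnitaryGroup.cmDatum L N H).Local v, Module.End.IsSemisimple (Matrix.toLin' ((s.val : GL (Fin N) (UnitaryGroup.LocalRing L v)).val : Matrix (Fin N) (Fin N) (UnitaryGroup.LocalRing L v))) →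
        ¬ IsRegularElt (s.val : GL (Fin N) (UnitaryGroup.LocalRing L v)) → s ∉ Subgroup.center ((UnitaryGroup.cmDatum L N H).Local v) →
        ∃ U : Set ((UnitaryGroup.cmDatum L N H).Local v), IsOpen U ∧ s ∈ U ∧
        ∃ B : ℝ, ∀ g ∈ U, ∀ u : (UnitaryGroup.LocalRing L v)ˣ,
          (u : UnitaryGroup.LocalRing L v) *
              (((g.val : GL (Fin N) (UnitaryGroup.LocalRing L v)).val : Matrix (Fin N) (Fin N) (UnitaryGroup.LocalRing L v)).det) ^ (N - 1) =
            (((g.val : GL (Fin N) (UnitaryGroup.LocalRing L v)).val : Matrix (Fin N) (Fin N) (UnitaryGroup.LocalRing L v)).charpoly).discr →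
          ((NNReal.sqrt (NNReal.sqrt (unitModulusChar (UnitaryGroup.LocalRing L v) u)) : ℝ≥0) : ℝ) * ‖Θ g‖ ≤ B := by
  sorry

set_option maxHeartbeats 1600000 in
set_option synthInstance.maxHeartbeats 400000 in
open scoped Classical in
open MeasureTheory.Measure Filter Topology Polynomial Literature.NumberTheory.GaloisRepresentations.IsNonarchimedeanLocalField Summit.HodgeConjecture.HodgeConjecture.Cruxes.H413.K2E3LieUnitary in
/-- **(12-D)** (as in SUBSIGS v1) «… near every NON-CENTRAL SINGULAR semisimple `s`» — Harish-Chandra's descent. [cite: HarishChandra1999AdmissibleDistributions, Thm. 16.3 p. 77, §18 pp. 78–79] 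
ED. 7 (K2E3-plan g2, 2026-09-04): HOSTED SOCKET (12-D) — statement bytes = K2E3-p12 (g3) `K2/K2E3-p12/g3/SUBSIGS-U12d-LieCore.v3.K2E3-p12-g3.lean` sha16 ac7d1d12b136db49 `subsig_K2E3NormalizedCharBddNearSingularDescent` VERBATIM (`subsig_` ↦ `sig_`); K2E3-r01 (g2) PRE-BOX PASS FIX 0 01:37:03Z. OPEN (payer files `Theorems/…lean --supports stmt-HodgeConjecture-24833 --as helper`, never importing `Lines`).
ED. 16 (K2E3-plan g3, 2026-09-04 ≈05:55Z): **RE-TIED RELATIVELY BY `N`** (socket bytes frozen): `N ≤ 2` ↦ (12D-le2) `sig_K2E3NormalizedCharBddNearSingularDescentLeTwo` ★; `3 ≤ N` ↦ (12D-ge3) `sig_K2E3NormalizedCharBddNearSingularDescentGeThree`; body = K2E3-p12 (g5) cand `recut_12D` VERBATIM (r01 PASS 05:25:24Z).  STATE: REL over EXACTLY {(12D-ge3)}. -/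
theorem sig_K2E3NormalizedCharBddNearSingularDescent :
    ∀ (L : Type) [Field L] [NumberField L] [IsCMField L] (N : ℕ) (H : Matrix (Fin N) (Fin N) L),
      (H.map (cmConjRingHom L))ᵀ = H → H.det ≠ 0 →
      ∀ (v : HeightOneSpectrum (𝓞 ↥(maximalRealSubfield L)))
        [MeasurableSpace ((UnitaryGroup.cmDatum L N H).Local v)] [BorelSpace ((UnitaryGroup.cmDatum L N H).Local v)]
        (μ : Measure ((UnitaryGroup.cmDatum L N H).Local v)) [μ.IsHaarMeasure]
        (c : IrrClass ((UnitaryGroup.cmDatum L N H).Local v)) (Θ : (UnitaryGroup.cmDatum L N H).Local v → ℂ),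
        LocallyIntegrable Θ μ →
        (∀ x : (UnitaryGroup.cmDatum L N H).Local v,
          IsRegularElt (x.val : GL (Fin N) (UnitaryGroup.LocalRing L v)) → ∀ᶠ y in 𝓝 x, Θ y = Θ x) →
        (∀ φ : (UnitaryGroup.cmDatum L N H).Local v → ℂ, IsLocSmooth φ → c.smoothTrace μ φ = ∫ x, φ x * Θ x ∂μ) →
      ∀ s : (UnitaryGroup.cmDatum L N H).Local v, Module.End.IsSemisimple (Matrix.toLin' ((s.val : GL (Fin N) (UnitaryGroup.LocalRing L v)).val : Matrix (Fin N) (Fin N) (UnitaryGroup.LocalRing L v))) →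
        ¬ IsRegularElt (s.val : GL (Fin N) (UnitaryGroup.LocalRing L v)) → s ∉ Subgroup.center ((UnitaryGroup.cmDatum L N H).Local v) →
        ∃ U : Set ((UnitaryGroup.cmDatum L N H).Local v), IsOpen U ∧ s ∈ U ∧
        ∃ B : ℝ, ∀ g ∈ U, ∀ u : (UnitaryGroup.LocalRing L v)ˣ,
          (u : UnitaryGroup.LocalRing L v) *
              (((g.val : GL (Fin N) (UnitaryGroup.LocalRing L v)).val : Matrix (Fin N) (Fin N) (UnitaryGroup.LocalRing L v)).det) ^ (N - 1) =
            (((g.val : GL (Fin N) (UnitaryGroup.LocalRing L v)).val : Matrix (Fin N) (Fin N) (UnitaryGroup.LocalRing L v)).charpoly).discr →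
          ((NNReal.sqrt (NNReal.sqrt (unitModulusChar (UnitaryGroup.LocalRing L v) u)) : ℝ≥0) : ℝ) * ‖Θ g‖ ≤ B := by
  intro L _ _ _ N
  by_cases hN : N ≤ 2
  · exact fun H => sig_K2E3NormalizedCharBddNearSingularDescentLeTwo L N hN H
  · exact fun H => sig_K2E3NormalizedCharBddNearSingularDescentGeThree L N (by omega) H

end Summit.HodgeConjecture.HodgeConjecture.Cruxes.H413.K2E3EllipticInputs.U12Characters

end
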